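import Summits.QuantumFields.YangMills.Theorems.BalabanUVNodesN15CovariantLandauTRowsFromFlat
import Summits.QuantumFields.YangMills.Theorems.BalabanUVNodesN15CovariantLandauTwoGridLandauLetter
import Summits.QuantumFields.YangMills.Theorems.BalabanUVNodesN15TwoSpacingGluingCurvedKnitCovariantLandauDefectRowPackaging
import HarnessLib

/-!
# Route «BalabanUVNodes», node N15 = NE2, road (c) — PROGRAMME (P-S), XLVII: THE TWO-GRID η-DEFECT ROW OF `N_V^R` FROM THE FOUR FLAT ROWS PER GRID, THE TRANSPORTER LETTERS, THE FLAT
# TWO-GRID KERNEL ROWS AND THE OSCILLATION∕FIT LETTERS — PACKAGED: `≤ S·K·e^{−(3δ/16)d}` with `S` the common η-scale of the small inputs and `K` INDEX-FREE (n15-c∕242 ∘ 252 ∘ 253) (dag-n15-c g25, n15-c∕254)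

Cell `pub-ymgap`, seat `pub-ymgap-dag-n15-c` (generation g25; R134 (a), s1; HUMAN RULING D-0062; chair R424 venue).  `bears_on: R4∕N15 · K3⁸ SpineGivenEndpointR13SepCoPHV
(stmt-QuantumFields-27366)`; filed `--supports stmt-QuantumFields-27366 --as helper` — COUNT-NEUTRAL.  One theorem; 0 `sorry`.  Imports BY NAME n15-c∕242 (`hasMaj_idef_landauCov_sub_landauRe_of_rows`), 252
(`tRows_of_flat''`), 253 (`defectRowConst_le`, `defectRowConst_nonneg`, `pk_reflQ`), 231 (`cXL cYL cAL cPL landauSmallConst`).  Generator `tools/g25/gen254.py` (kept with the seat).  Nothing in the tree is modified.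

WHY.  n15-c∕243∕242 display the one-grid `T`-rows (`hX hY hDT hSi`, both grids) and the smallness of the fine Neumann steps; n15-c∕252 makes the `T`-rows theorems of the FLAT rows + letters,
n15-c∕253 packages the explicit constant.  THIS FILE composes: hypotheses = per grid the four flat rows + `S̄ₕ∂G′(1)` + the letters `ρ, λ, σ` with their `r`-scalings (as n15-c∕231), the flat two-grid
kernel rows `ε_•`, the oscillation∕fit letters `ω_•, φ_•` (as n15-c∕242), the smallness thresholds, and the common η-scale `S` of the eleven small inputs (`x ≤ S·K_x`); conclusion = the two-grid
η-defect row of `N_V^R` bounded by `S·K·e^{−(3δ/16)d}` with `K` an explicit polynomial in index-free constants (the 43 letter-free sub-words bounded inside: `nρ ≤ C_ρ`, `n²λ ≤ C_l`,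
`α(στ+σ) ≤ 3C_σ`, `τ ≤ 2`, `(1 − θc)⁻¹ ≤ 2`, …).
* ★★★ **`hasMaj_idef_landauCov_sub_landauRe_of_flat''`**.

HONEST FRAMING ∕ LIMITS.  Bookkeeping over landed theorems; flat rows, kernel two-grid rows and oscillation letters are HYPOTHESES here (theorems by dag-n15-a (Ξ-6) and n15-c∕247–250 at the node);
MODEL carriers; NOT [Balaban1985BackgroundPropagators] (3.49) ∕ Thm 3.4 ∕ Thm 3.14 as printed; NE2⁺ NOT PRINTED; N15 of record untouched (DISCHARGED AS CONSUMED, p687738); counts UNMOVED (typed 28∕28 ·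
discharged 8∕27); one finite 𝕋⁴ at fixed ε per index — NOT infinite volume ∕ OS ∕ mass gap ∕ Clay.  Restate-immune (no Theses import).
-/

noncomputable section

open scoped BigOperators Matrix
open Finset

namespace Summit.QuantumFields.YangMills.BalabanUVNodes.N15.CovLandau

open Literature.MathematicalPhysics.QuantumFieldTheory.Balaban1983to89
open Literature.MathematicalPhysics.QuantumFieldTheory.Balaban1983to89.B5Prop11Plancherel (Tor fine unitVec)
open Literature.MathematicalPhysics.QuantumFieldTheory.Balaban1983to89.B11SectG (BlockNorm HasMaj RowSum)
open Literature.MathematicalPhysics.QuantumFieldTheory.Balaban1983to89.B6UnitTorusCarrier (unitTorusGeo rowSum_unitTorusGeo unitTorusGeo_dist_nonneg)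
open Literature.MathematicalPhysics.QuantumFieldTheory.Balaban1983to89.T4EtaRateDefect (idef)
open Literature.MathematicalPhysics.QuantumFieldTheory.Balaban1983to89.T4EtaRateCoeffDefect (pull)
open Literature.MathematicalPhysics.QuantumFieldTheory.King1986.Torus (blockOf tdistT)
open Summit.QuantumFields.YangMills.BalabanUVNodes.N15.MatrixSpecies (liftBlk liftMap)
open Summit.QuantumFields.YangMills.BalabanUVNodes.N15.VectorPiece (kingPr kingPrV tensorId)
open Summit.QuantumFields.YangMills.BalabanUVNodes.N15.CovAvg (cvaStair cvaStair_one rows_le_of_rows_sub_one cols_le_of_cols_sub_one)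
open Summit.QuantumFields.YangMills.BalabanUVNodes.N15.TwoGrid (landauRe)
open Summit.QuantumFields.YangMills.BalabanUVNodes.N15.Gluing (defectRowConst_le defectRowConst_nonneg pk_reflQ)

variable {d : ℕ}

section Main

variable (M : Fin (d + 1) → ℕ) [∀ μ, NeZero (M μ)] {ι : Type} [Fintype ι] [DecidableEq ι] (L k m : ℕ) [NeZero L]

set_option maxHeartbeats 4000000 in
/-- ★★★ **THE TWO-GRID η-DEFECT ROW OF `N_V^R` FROM FLAT ROWS, LETTERS, KERNEL TWO-GRID ROWS AND OSCILLATION LETTERS, PACKAGED** (`≤ S·K·e^{−(3δ/16)d}`, `K` index-free).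
[cite: Balaban1985BackgroundPropagators, (3.49) p.399, Thm 3.4 p.400, Lemma 3.3 p.402, Thm 3.14 pp.426–427 (mechanism); King1986, p.664, Prop. 3.9 (3.73) p.665 (shape of the η-rate)] -/
theorem hasMaj_idef_landauCov_sub_landauRe_of_flat''
    {T : Fin (d + 1) → Tor (fine (L ^ k) M) → Matrix ι ι ℝ} (hT : ∀ ν x, IsUnit (T ν x)) {a : ℝ} (ha : 0 < a)
    {T' : Fin (d + 1) → Tor (fine (L ^ m * L ^ k) M) → Matrix ι ι ℝ} (hT' : ∀ ν x, IsUnit (T' ν x)) {a' : ℝ} (ha' : 0 < a')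
    {δ CG CA CD CDb CS Cρ Cl Cσ α r ρ lam σ ρ₁ lam₁ σ₁ εG εA εD εDb ωN ωVt ωV ωm φQ φt : ℝ} (hδ : 0 < δ) (hCG : 0 ≤ CG) (hCA : 0 ≤ CA) (hCD : 0 ≤ CD) (hCDb : 0 ≤ CDb) (hCS : 0 ≤ CS)
    (hCρ : 0 ≤ Cρ) (hCl : 0 ≤ Cl) (hCσ : 0 ≤ Cσ) (hα : 0 ≤ α) (hr0 : 0 ≤ r) (hr1 : r ≤ 1) (hρ0 : 0 ≤ ρ) (hlam0 : 0 ≤ lam) (hσ0 : 0 ≤ σ) (hρ₁0 : 0 ≤ ρ₁) (hlam₁0 : 0 ≤ lam₁) (hσ₁0 : 0 ≤ σ₁)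
    (hεG : 0 ≤ εG) (hεA : 0 ≤ εA) (hεD : 0 ≤ εD) (hεDb : 0 ≤ εDb) (hωN0 : 0 ≤ ωN) (hωVt0 : 0 ≤ ωVt) (hωV0 : 0 ≤ ωV) (hωm0 : 0 ≤ ωm) (hφQ0 : 0 ≤ φQ) (hφt0 : 0 ≤ φt)
    -- coarse grid: letters, scalings, the four flat rows + `S̄ₕ∂G′(1)`
    (hρr : ∀ ν x i, ∑ j, |(T ν x - (fun (_ : Fin (d + 1)) (_ : Tor (fine (L ^ k) M)) => (1 : Matrix ι ι ℝ)) ν x) i j| ≤ ρ)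
    (hρc : ∀ ν x j, ∑ i, |(T ν x - (fun (_ : Fin (d + 1)) (_ : Tor (fine (L ^ k) M)) => (1 : Matrix ι ι ℝ)) ν x) i j| ≤ ρ)
    (hlamr : ∀ μ (z : Tor (fine (L ^ k) M)) i, ∑ j, |(T μ z - T μ (z - unitVec (fine (L ^ k) M) μ)) i j| ≤ lam)
    (hlamc : ∀ μ (z : Tor (fine (L ^ k) M)) i, ∑ j, |(T μ z - T μ (z - unitVec (fine (L ^ k) M) μ)) j i| ≤ lam)
    (hσr : ∀ y aa i, ∑ j, |(cvaStair M (L ^ k) (fun μ b => T μ b.1) y aa 0 - cvaStair M (L ^ k) (fun μ b => (fun (_ : Fin (d + 1)) (_ : Tor (fine (L ^ k) M)) => (1 : Matrix ι ι ℝ)) μ b.1) y aa 0) i j| ≤ σ)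
    (hσc : ∀ y aa j, ∑ i, |(cvaStair M (L ^ k) (fun μ b => T μ b.1) y aa 0 - cvaStair M (L ^ k) (fun μ b => (fun (_ : Fin (d + 1)) (_ : Tor (fine (L ^ k) M)) => (1 : Matrix ι ι ℝ)) μ b.1) y aa 0) i j| ≤ σ)
    (hnρ : (((L ^ k : ℕ) : ℝ)) * ρ ≤ Cρ * r) (hnlam : (((L ^ k : ℕ) : ℝ)) * ((((L ^ k : ℕ) : ℝ)) * lam) ≤ Cl * r) (hσle : σ ≤ Cσ * r) (haα : |a| * ((((L ^ k : ℕ) : ℝ)) ^ (d + 1))⁻¹ ≤ α)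
    (hG1 : HasMaj (BlockNorm.ofBlocks (unitTorusGeo L k M) (liftBlk (blockOf (L ^ k) M) ι)) (BlockNorm.ofBlocks (unitTorusGeo L k M) (liftBlk (blockOf (L ^ k) M) ι)) (Matrix.mulVecLin (cGreen M (L ^ k) (fun (_ : Fin (d + 1)) (_ : Tor (fine (L ^ k) M)) => (1 : Matrix ι ι ℝ)) a)) (fun y y' => CG * Real.exp (-(δ * tdistT M y y'))))
    (hA1 : HasMaj (BlockNorm.ofBlocks (unitTorusGeo L k M) (liftBlk (fun b : Tor (fine (L ^ k) M) × Fin (d + 1) => blockOf (L ^ k) M b.1) ι)) (BlockNorm.ofBlocks (unitTorusGeo L k M) (liftBlk (blockOf (L ^ k) M) ι)) (Matrix.mulVecLin (cGreen M (L ^ k) (fun (_ : Fin (d + 1)) (_ : Tor (fine (L ^ k) M)) => (1 : Matrix ι ι ℝ)) a * (cgrad M (L ^ k) (fun (_ : Fin (d + 1)) (_ : Tor (fine (L ^ k) M)) => (1 : Matrix ι ι ℝ)))ᵀ)) (fun y y' => CA * Real.exp (-(δ * tdistT M y y'))))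
    (hD1 : HasMaj (BlockNorm.ofBlocks (unitTorusGeo L k M) (liftBlk (blockOf (L ^ k) M) ι)) (BlockNorm.ofBlocks (unitTorusGeo L k M) (liftBlk (fun b : Tor (fine (L ^ k) M) × Fin (d + 1) => blockOf (L ^ k) M b.1) ι)) (Matrix.mulVecLin (cgrad M (L ^ k) (fun (_ : Fin (d + 1)) (_ : Tor (fine (L ^ k) M)) => (1 : Matrix ι ι ℝ)) * cGreen M (L ^ k) (fun (_ : Fin (d + 1)) (_ : Tor (fine (L ^ k) M)) => (1 : Matrix ι ι ℝ)) a)) (fun y y' => CD * Real.exp (-(δ * tdistT M y y'))))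
    (hS1 : HasMaj (BlockNorm.ofBlocks (unitTorusGeo L k M) (liftBlk (fun y : Tor M => y) ι)) (BlockNorm.ofBlocks (unitTorusGeo L k M) (liftBlk (fun y : Tor M => y) ι)) (Matrix.mulVecLin (cSop M (L ^ k) (fun (_ : Fin (d + 1)) (_ : Tor (fine (L ^ k) M)) => (1 : Matrix ι ι ℝ)) a)⁻¹) (fun y y' => CS * (((L ^ k : ℕ) : ℝ)) ^ (d + 1) * Real.exp (-(δ * tdistT M y y'))))
    (hD1b : HasMaj (BlockNorm.ofBlocks (unitTorusGeo L k M) (liftBlk (blockOf (L ^ k) M) ι)) (BlockNorm.ofBlocks (unitTorusGeo L k M) (liftBlk (fun b : Tor (fine (L ^ k) M) × Fin (d + 1) => blockOf (L ^ k) M b.1) ι)) (Matrix.mulVecLin ((bBack M (L ^ k) (ι := ι)) * ((cgrad M (L ^ k) (fun (_ : Fin (d + 1)) (_ : Tor (fine (L ^ k) M)) => (1 : Matrix ι ι ℝ))) * (cGreen M (L ^ k) (fun (_ : Fin (d + 1)) (_ : Tor (fine (L ^ k) M)) => (1 : Matrix ι ι ℝ)) a)))) (fun y y' => CDb * Real.exp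 (-(δ * tdistT M y y'))))
    -- fine grid
    (hρr' : ∀ ν x i, ∑ j, |(T' ν x - (fun (_ : Fin (d + 1)) (_ : Tor (fine (L ^ m * L ^ k) M)) => (1 : Matrix ι ι ℝ)) ν x) i j| ≤ ρ₁)
    (hρc' : ∀ ν x j, ∑ i, |(T' ν x - (fun (_ : Fin (d + 1)) (_ : Tor (fine (L ^ m * L ^ k) M)) => (1 : Matrix ι ι ℝ)) ν x) i j| ≤ ρ₁)
    (hlamr' : ∀ μ (z : Tor (fine (L ^ m * L ^ k) M)) i, ∑ j, |(T' μ z - T' μ (z - unitVec (fine (L ^ m * L ^ k) M) μ)) i j| ≤ lam₁)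
    (hlamc' : ∀ μ (z : Tor (fine (L ^ m * L ^ k) M)) i, ∑ j, |(T' μ z - T' μ (z - unitVec (fine (L ^ m * L ^ k) M) μ)) j i| ≤ lam₁)
    (hσr' : ∀ y aa i, ∑ j, |(cvaStair M (L ^ m * L ^ k) (fun μ b => T' μ b.1) y aa 0 - cvaStair M (L ^ m * L ^ k) (fun μ b => (fun (_ : Fin (d + 1)) (_ : Tor (fine (L ^ m * L ^ k) M)) => (1 : Matrix ι ι ℝ)) μ b.1) y aa 0) i j| ≤ σ₁)
    (hσc' : ∀ y aa j, ∑ i, |(cvaStair M (L ^ m * L ^ k) (fun μ b => T' μ b.1) y aa 0 - cvaStair M (L ^ m * L ^ k) (fun μ b => (fun (_ : Fin (d + 1)) (_ : Tor (fine (L ^ m * L ^ k) M)) => (1 : Matrix ι ι ℝ)) μ b.1) y aa 0) i j| ≤ σ₁)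
    (hnρ' : (((L ^ m * L ^ k : ℕ) : ℝ)) * ρ₁ ≤ Cρ * r) (hnlam' : (((L ^ m * L ^ k : ℕ) : ℝ)) * ((((L ^ m * L ^ k : ℕ) : ℝ)) * lam₁) ≤ Cl * r) (hσle' : σ₁ ≤ Cσ * r) (haα' : |a'| * ((((L ^ m * L ^ k : ℕ) : ℝ)) ^ (d + 1))⁻¹ ≤ α)
    (hG1' : HasMaj (BlockNorm.ofBlocks (unitTorusGeo L k M) (liftBlk (blockOf (L ^ m * L ^ k) M) ι)) (BlockNorm.ofBlocks (unitTorusGeo L k M) (liftBlk (blockOf (L ^ m * L ^ k) M) ι)) (Matrix.mulVecLin (cGreen M (L ^ m * L ^ k) (fun (_ : Fin (d + 1)) (_ : Tor (fine (L ^ m * L ^ k) M)) => (1 : Matrix ι ι ℝ)) a')) (fun y y' => CG * Real.exp (-(δ * tdistT M y y'))))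
    (hA1' : HasMaj (BlockNorm.ofBlocks (unitTorusGeo L k M) (liftBlk (fun b : Tor (fine (L ^ m * L ^ k) M) × Fin (d + 1) => blockOf (L ^ m * L ^ k) M b.1) ι)) (BlockNorm.ofBlocks (unitTorusGeo L k M) (liftBlk (blockOf (L ^ m * L ^ k) M) ι)) (Matrix.mulVecLin (cGreen M (L ^ m * L ^ k) (fun (_ : Fin (d + 1)) (_ : Tor (fine (L ^ m * L ^ k) M)) => (1 : Matrix ι ι ℝ)) a' * (cgrad M (L ^ m * L ^ k) (fun (_ : Fin (d + 1)) (_ : Tor (fine (L ^ m * L ^ k) M)) => (1 : Matrix ι ι ℝ)))ᵀ)) (fun y y' => CA * Real.exp (-(δ * tdistT M y y'))))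
    (hD1' : HasMaj (BlockNorm.ofBlocks (unitTorusGeo L k M) (liftBlk (blockOf (L ^ m * L ^ k) M) ι)) (BlockNorm.ofBlocks (unitTorusGeo L k M) (liftBlk (fun b : Tor (fine (L ^ m * L ^ k) M) × Fin (d + 1) => blockOf (L ^ m * L ^ k) M b.1) ι)) (Matrix.mulVecLin (cgrad M (L ^ m * L ^ k) (fun (_ : Fin (d + 1)) (_ : Tor (fine (L ^ m * L ^ k) M)) => (1 : Matrix ι ι ℝ)) * cGreen M (L ^ m * L ^ k) (fun (_ : Fin (d + 1)) (_ : Tor (fine (L ^ m * L ^ k) M)) => (1 : Matrix ι ι ℝ)) a')) (fun y y' => CD * Real.exp (-(δ * tdistT M y y'))))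
    (hS1' : HasMaj (BlockNorm.ofBlocks (unitTorusGeo L k M) (liftBlk (fun y : Tor M => y) ι)) (BlockNorm.ofBlocks (unitTorusGeo L k M) (liftBlk (fun y : Tor M => y) ι)) (Matrix.mulVecLin (cSop M (L ^ m * L ^ k) (fun (_ : Fin (d + 1)) (_ : Tor (fine (L ^ m * L ^ k) M)) => (1 : Matrix ι ι ℝ)) a')⁻¹) (fun y y' => CS * (((L ^ m * L ^ k : ℕ) : ℝ)) ^ (d + 1) * Real.exp (-(δ * tdistT M y y'))))
    (hD1b' : HasMaj (BlockNorm.ofBlocks (unitTorusGeo L k M) (liftBlk (blockOf (L ^ m * L ^ k) M) ι)) (BlockNorm.ofBlocks (unitTorusGeo L k M) (liftBlk (fun b : Tor (fine (L ^ m * L ^ k) M) × Fin (d + 1) => blockOf (L ^ m * L ^ k) M b.1) ι)) (Matrix.mulVecLin ((bBack M (L ^ m * L ^ k) (ι := ι)) * ((cgrad M (L ^ m * L ^ k) (fun (_ : Fin (d + 1)) (_ : Tor (fine (L ^ m * L ^ k) M)) => (1 : Matrix ι ι ℝ))) * (cGreen M (L ^ m * L ^ k) (fun (_ : Fin (d +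 1)) (_ : Tor (fine (L ^ m * L ^ k) M)) => (1 : Matrix ι ι ℝ)) a')))) (fun y y' => CDb * Real.exp (-(δ * tdistT M y y'))))
    -- the flat two-grid kernel rows (rate `δ`)
    (hDG : HasMaj (BlockNorm.ofBlocks (unitTorusGeo L k M) (liftBlk (blockOf (L ^ k) M) ι)) (BlockNorm.ofBlocks (unitTorusGeo L k M) (liftBlk (blockOf (L ^ m * L ^ k) M) ι)) (idef (pull (liftMap (kingPr L k m M) ι)) (pull (liftMap (kingPr L k m M) ι)) (Matrix.mulVecLin (cGreen M (L ^ m * L ^ k) (fun (_ : Fin (d + 1)) (_ : Tor (fine (L ^ m * L ^ k) M)) => (1 : Matrix ι ι ℝ)) a')) (Matrix.mulVecLin (cGreen M (L ^ k) (fun (_ : Fin (d + 1)) (_ : Tor (fine (L ^ k) M)) => (1 : Matrix ι ι ℝ)) a))) (fun y y' => εG * Real.exp (-(δ * tdistT M y y'))))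
    (hDA : HasMaj (BlockNorm.ofBlocks (unitTorusGeo L k M) (liftBlk (fun b : Tor (fine (L ^ k) M) × Fin (d + 1) => blockOf (L ^ k) M b.1) ι)) (BlockNorm.ofBlocks (unitTorusGeo L k M) (liftBlk (blockOf (L ^ m * L ^ k) M) ι)) (idef (pull (liftMap (kingPrV L k m M) ι)) (pull (liftMap (kingPr L k m M) ι)) (Matrix.mulVecLin ((cGreen M (L ^ m * L ^ k) (fun (_ : Fin (d + 1)) (_ : Tor (fine (L ^ m * L ^ k) M)) => (1 : Matrix ι ι ℝ)) a') * ((cgrad M (L ^ m * L ^ k) (fun (_ : Fin (d + 1)) (_ : Tor (fine (L ^ m * L ^ k) M)) => (1 : Matrix ι ι ℝ))))ᵀ)) (Matrix.mulVecLin ((cGreen M (L ^ k) (fun (_ : Fin (d + 1)) (_ : Tor (fine (L ^ k) M)) => (1 : Matrix ι ι ℝ)) a) * ((cgrad M (L ^ k) (fun (_ : Fin (d + 1)) (_ : Tor (fine (L ^ k) M)) => (1 : Matrix ι ι ℝ))))ᵀ))) (fun y y' => εA * Real.exp (-(δ * tdistT M y y'))))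
    (hDD : HasMaj (BlockNorm.ofBlocks (unitTorusGeo L k M) (liftBlk (blockOf (L ^ k) M) ι)) (BlockNorm.ofBlocks (unitTorusGeo L k M) (liftBlk (fun b : Tor (fine (L ^ m * L ^ k) M) × Fin (d + 1) => blockOf (L ^ m * L ^ k) M b.1) ι)) (idef (pull (liftMap (kingPr L k m M) ι)) (pull (liftMap (kingPrV L k m M) ι)) (Matrix.mulVecLin ((cgrad M (L ^ m * L ^ k) (fun (_ : Fin (d + 1)) (_ : Tor (fine (L ^ m * L ^ k) M)) => (1 : Matrix ι ι ℝ))) * (cGreen M (L ^ m * L ^ k) (fun (_ : Fin (d + 1)) (_ : Tor (fine (L ^ m * L ^ k) M)) => (1 : Matrix ι ι ℝ)) a'))) (Matrix.mulVecLin ((cgrad M (L ^ k) (fun (_ : Fin (d + 1)) (_ : Tor (fine (L ^ k) M)) => (1 : Matrix ι ι ℝ))) * (cGreen M (L ^ k) (fun (_ : Fin (d + 1)) (_ : Tor (fine (L ^ k) M)) => (1 : Matrix ι ι ℝ)) a)))) (fun y y' => εD * Real.exp (-(δ * tdistT M y y'))))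
    (hDDb : HasMaj (BlockNorm.ofBlocks (unitTorusGeo L k M) (liftBlk (blockOf (L ^ k) M) ι)) (BlockNorm.ofBlocks (unitTorusGeo L k M) (liftBlk (fun b : Tor (fine (L ^ m * L ^ k) M) × Fin (d + 1) => blockOf (L ^ m * L ^ k) M b.1) ι)) (idef (pull (liftMap (kingPr L k m M) ι)) (pull (liftMap (kingPrV L k m M) ι)) (Matrix.mulVecLin ((bBack M (L ^ m * L ^ k) (ι := ι)) * ((cgrad M (L ^ m * L ^ k) (fun (_ : Fin (d + 1)) (_ : Tor (fine (L ^ m * L ^ k) M)) => (1 : Matrix ι ι ℝ))) * (cGreen M (L ^ m * L ^ k) (fun (_ : Fin (d + 1)) (_ : Tor (fine (L ^ m * L ^ k) M)) => (1 : Matrix ι ι ℝ)) a')))) (Matrix.mulVecLin ((bBack M (L ^ k) (ι := ι)) * ((cgrad M (L ^ k) (fun (_ : Fin (d + 1)) (_ : Tor (fine (L ^ k) M)) => (1 : Matrix ι ι ℝ))) * (cGreen M (L ^ k) (fun (_ : Fin (d + 1)) (_ : Tor (fine (L ^ k) M)) => (1 : Matrix ι ι ℝ)) a))))) (fun y y'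 => εDb * Real.exp (-(δ * tdistT M y y'))))
    -- oscillation letters and the two block-diagonal two-grid letter rows
    (hωNr : ∀ ν x' i, ∑ j, |((fun ν x => (((L ^ m * L ^ k : ℕ) : ℝ)) • ((1 : Matrix ι ι ℝ) - T' ν x)) ν x' - (fun ν x => (((L ^ k : ℕ) : ℝ)) • ((1 : Matrix ι ι ℝ) - T ν x)) ν (kingPr L k m M x')) i j| ≤ ωN)
    (hωNc : ∀ ν x' i, ∑ j, |((fun ν x => (((L ^ m * L ^ k : ℕ) : ℝ)) • ((1 : Matrix ι ι ℝ) - T' ν x)) ν x' - (fun ν x => (((L ^ k : ℕ) : ℝ)) • ((1 : Matrix ι ι ℝ) - T ν x)) ν (kingPr L k m M x')) j i| ≤ ωN)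
    (hωNt : ∀ μ x' i, ∑ j, |((fun μ z => ((((L ^ m * L ^ k : ℕ) : ℝ)) • ((1 : Matrix ι ι ℝ) - T' μ (z - unitVec (fine (L ^ m * L ^ k) M) μ)))ᵀ) μ x' - (fun μ z => ((((L ^ k : ℕ) : ℝ)) • ((1 : Matrix ι ι ℝ) - T μ (z - unitVec (fine (L ^ k) M) μ)))ᵀ) μ (kingPr L k m M x')) i j| ≤ ωN)
    (hωVt : ∀ x' i, ∑ j, |((fun z => (bDiv M (L ^ m * L ^ k) (fun ν x => (((L ^ m * L ^ k : ℕ) : ℝ)) • ((1 : Matrix ι ι ℝ) - T' ν x)) z)ᵀ) x' - (fun z => (bDiv M (L ^ k) (fun ν x => (((L ^ k : ℕ) : ℝ)) • ((1 : Matrix ι ι ℝ) - T ν x)) z)ᵀ) (kingPr L k m M x')) i j| ≤ ωVt)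
    (hωV : ∀ x' i, ∑ j, |((bDiv M (L ^ m * L ^ k) (fun ν x => (((L ^ m * L ^ k : ℕ) : ℝ)) • ((1 : Matrix ι ι ℝ) - T' ν x))) x' - (bDiv M (L ^ k) (fun ν x => (((L ^ k : ℕ) : ℝ)) • ((1 : Matrix ι ι ℝ) - T ν x))) (kingPr L k m M x')) i j| ≤ ωV)
    (hωm : ∀ x' i, ∑ j, |((fun z => ∑ μ, ((fun ν x => (((L ^ m * L ^ k : ℕ) : ℝ)) • ((1 : Matrix ι ι ℝ) - T' ν x)) μ (z - unitVec (fine (L ^ m * L ^ k) M) μ))ᵀ * (fun ν x => (((L ^ m * L ^ k : ℕ) : ℝ)) • ((1 : Matrix ι ι ℝ) - T' ν x)) μ (z - unitVec (fine (L ^ m * L ^ k) M) μ)) x' - (fun z => ∑ μ, ((fun ν x => (((L ^ k : ℕ) : ℝ)) • ((1 : Matrix ι ι ℝ) - T ν x)) μ (z - unitVec (fine (L ^ k) M) μ))ᵀ * (fun ν x => (((L ^ k : ℕ) : ℝ)) • ((1 : Matrix ι ι ℝ) - T ν x)) μ (z - unitVec (fine (L ^ k) M) μ)) (kingPr L k m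 M x')) i j| ≤ ωm)
    (hDQ : HasMaj (BlockNorm.ofBlocks (unitTorusGeo L k M) (liftBlk (blockOf (L ^ k) M) ι)) (BlockNorm.ofBlocks (unitTorusGeo L k M) (liftBlk (blockOf (L ^ m * L ^ k) M) ι)) (idef (pull (liftMap (kingPr L k m M) ι)) (pull (liftMap (kingPr L k m M) ι)) (Matrix.mulVecLin (a' • (((csavg M (L ^ m * L ^ k) (fun (_ : Fin (d + 1)) (_ : Tor (fine (L ^ m * L ^ k) M)) => (1 : Matrix ι ι ℝ))))ᵀ * (csavg M (L ^ m * L ^ k) (fun (_ : Fin (d + 1)) (_ : Tor (fine (L ^ m * L ^ k) M)) => (1 : Matrix ι ι ℝ))) - ((csavg M (L ^ m * L ^ k) T'))ᵀ * (csavg M (L ^ m * L ^ k) T')))) (Matrix.mulVecLin (a • (((csavg M (L ^ k) (fun (_ : Fin (d + 1)) (_ : Tor (fine (L ^ k) M)) => (1 : Matrix ι ι ℝ))))ᵀ * (csavg M (L ^ k) (fun (_ : Fin (d + 1)) (_ : Tor (fine (L ^ k) M)) => (1 : Matrix ι ι ℝ))) - ((csavg M (L ^ k) T))ᵀ * (csavg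 M (L ^ k) T))))) (fun y y' => if y = y' then φQ else 0))
    (hDQt : HasMaj (BlockNorm.ofBlocks (unitTorusGeo L k M) (liftBlk (fun y : Tor M => y) ι)) (BlockNorm.ofBlocks (unitTorusGeo L k M) (liftBlk (blockOf (L ^ m * L ^ k) M) ι)) (idef (((((L ^ m) ^ (d + 1) : ℕ) : ℝ)) • (LinearMap.id : (Tor M × ι → ℝ) →ₗ[ℝ] (Tor M × ι → ℝ))) (pull (liftMap (kingPr L k m M) ι)) (Matrix.mulVecLin (csavg M (L ^ m * L ^ k) T')ᵀ) (Matrix.mulVecLin (csavg M (L ^ k) T)ᵀ)) (fun y y' => if y = y' then (((((L ^ k : ℕ) : ℝ)) ^ (d + 1)))⁻¹ * φt else 0))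
    -- smallness (n15-c∕231's threshold on both grids; the fine Neumann steps of n15-c∕236–237 at rate `3δ/8`)
    (hsmallL : (2 * cXL ((d : ℝ) + 1) CG CA Cρ Cl Cσ α (B4Sect5Proof.latticeConst (d + 1) (δ / 8)) δ (δ / 8) * B4Sect5Proof.latticeConst (d + 1) (δ / 8)
        + 2 * cYL ((d : ℝ) + 1) CD Cρ (B4Sect5Proof.latticeConst (d + 1) (δ / 8)) δ * B4Sect5Proof.latticeConst (d + 1) (δ / 8) + Cσ) * r ≤ 1)
    (hsmall : landauSmallConst ((d : ℝ) + 1) (Fintype.card ι) CG CA CD CS (cPL ((d : ℝ) + 1) CG CD Cρ Cl Cσ α (B4Sect5Proof.latticeConst (d + 1) (δ / 8)) δ (δ / 8)) Cρ Cσ α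
        (B4Sect5Proof.latticeConst (d + 1) (δ / 2 / 16)) (δ / 2) * r ≤ 1)
    (hsmallK2 : cXL ((d : ℝ) + 1) CG CA Cρ Cl Cσ α (B4Sect5Proof.latticeConst (d + 1) (3 * δ / 160)) (3 * δ / 8) (3 * δ / 160) * (B4Sect5Proof.latticeConst (d + 1) (3 * δ / 160)) * r ≤ 1 / 2)
    (hsmallZ : ((d : ℝ) + 1) * Cρ * (CDb + CD) * (B4Sect5Proof.latticeConst (d + 1) (3 * δ / 160)) * r ≤ 1 / 2)
    -- the common η-scale of the small inputs
    {S KεG KεA KεD KεDb KωN KωVt KωV Kωm KφQ Kφt Kninv : ℝ} (hS0 : 0 ≤ S)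
    (hPεG : 0 ≤ εG ∧ 0 ≤ KεG ∧ εG ≤ S * KεG)
    (hPεA : 0 ≤ εA ∧ 0 ≤ KεA ∧ εA ≤ S * KεA)
    (hPεD : 0 ≤ εD ∧ 0 ≤ KεD ∧ εD ≤ S * KεD)
    (hPεDb : 0 ≤ εDb ∧ 0 ≤ KεDb ∧ εDb ≤ S * KεDb)
    (hPωN : 0 ≤ ωN ∧ 0 ≤ KωN ∧ ωN ≤ S * KωN)
    (hPωVt : 0 ≤ ωVt ∧ 0 ≤ KωVt ∧ ωVt ≤ S * KωVt)
    (hPωV : 0 ≤ ωV ∧ 0 ≤ KωV ∧ ωV ≤ S * KωV)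
    (hPωm : 0 ≤ ωm ∧ 0 ≤ Kωm ∧ ωm ≤ S * Kωm)
    (hPφQ : 0 ≤ φQ ∧ 0 ≤ KφQ ∧ φQ ≤ S * KφQ)
    (hPφt : 0 ≤ φt ∧ 0 ≤ Kφt ∧ φt ≤ S * Kφt)
    (hPninv : 0 ≤ ((((L ^ k : ℕ) : ℝ)))⁻¹ ∧ 0 ≤ Kninv ∧ ((((L ^ k : ℕ) : ℝ)))⁻¹ ≤ S * Kninv) :
    HasMaj (BlockNorm.ofBlocks (unitTorusGeo L k M) (liftBlk (fun b : Tor (fine (L ^ k) M) × Fin (d + 1) => blockOf (L ^ k) M b.1) ι)) (BlockNorm.ofBlocks (unitTorusGeo L k M) (liftBlk (fun b : Tor (fine (L ^ m * L ^ k) M) × Fin (d + 1) => blockOf (L ^ m * L ^ k) M b.1) ι)) (idef (pull (liftMap (kingPrV L k m M) ι)) (pull (liftMap (kingPrV L k m M) ι)) (Matrix.mulVecLin (landauCov M (L ^ m * L ^ k) T' a') - tensorId ι (landauRe M (L ^ m * L ^ k))) (Matrix.mulVecLin (landauCov M (L ^ k) T a) - tensorId ι (landauRe M (L ^ k))))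
      (fun y y' => S * ((CD + cPL ((d : ℝ) + 1) CG CD Cρ Cl Cσ α (B4Sect5Proof.latticeConst (d + 1) (δ / 8)) δ (δ / 8)) * 2 * (2 * CS * (((d : ℝ) + 1) * Fintype.card ι * (2 * (CD + cAL ((d : ℝ) + 1) CD Cρ Cl Cσ α (B4Sect5Proof.latticeConst (d + 1) (δ / 8)) δ (δ / 8) * (2 * CG) * B4Sect5Proof.latticeConst (d + 1) (δ / 8)) * Kφt + (KεD + CD * ((((d : ℝ) + 1) * Cl + ((d : ℝ) + 1) * (Cρ * Cρ) + α * (3 * Cσ)) * ((KεG + CA * (KωN * (Real.exp (3 * δ / 8 + 3 * δ / 160) * (2 * CG) * B4Sect5Proof.latticeConst (d + 1) (3 * δ / 160)) + Kninv * Cρ * (2 * (CD + cAL ((d : ℝ) + 1) CD Cρ Cl Cσ α (B4Sect5Proof.latticeConst (d + 1) (δ / 8)) δ (δ / 8) * (2 * CG) * B4Sect5Proof.latticeConst (d + 1) (δ / 8)))) * B4Sect5Proof.latticeConst (d + 1) (3 * δ / 160) + KεA * (Cρ * Real.exp (3 * δ / 8 + 3 * δ / 160) * (2 * CG) * B4Sect5Proof.latticeConst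 (d + 1) (3 * δ / 160)) * B4Sect5Proof.latticeConst (d + 1) (3 * δ / 160) + CG * (KωVt * (2 * CG)) * B4Sect5Proof.latticeConst (d + 1) (3 * δ / 160) + KεG * (((d : ℝ) + 1) * Cl * (2 * CG)) * B4Sect5Proof.latticeConst (d + 1) (3 * δ / 160) + CA * (KωN * (2 * CG)) * B4Sect5Proof.latticeConst (d + 1) (3 * δ / 160) + KεA * (Cρ * (2 * CG)) * B4Sect5Proof.latticeConst (d + 1) (3 * δ / 160) + CG * (Kωm * (2 * CG)) * B4Sect5Proof.latticeConst (d + 1) (3 * δ / 160) + KεG * (((d : ℝ) + 1) * (Cρ * Cρ) * (2 * CG)) * B4Sect5Proof.latticeConst (d + 1) (3 * δ / 160) + CG * (KφQ * (2 * CG)) * B4Sect5Proof.latticeConst (d + 1) (3 * δ / 160) + KεG * (α * (3 * Cσ) * (2 * CG)) * B4Sect5Proof.latticeConst (d + 1) (3 * δ / 160)) * 2) + (KωV + Kωm + KφQ) * (2 * CG)) * B4Sect5Proof.latticeConst (d + 1) (3 * δ / 160) + KεD * ((((d : ℝ) + 1) * Cl + ((d : ℝ) + 1) * (Cρ * Cρ)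 + α * (3 * Cσ)) * (2 * CG)) * B4Sect5Proof.latticeConst (d + 1) (3 * δ / 160) + CD * ((((d : ℝ) + 1) * Cρ * KεDb + ((d : ℝ) + 1) * KωN * CDb + ((d : ℝ) + 1) * Cρ * KεD + ((d : ℝ) + 1) * KωN * CD + ((d : ℝ) + 1) * Cρ * (CDb + CD) * ((((d : ℝ) + 1) * Cl + ((d : ℝ) + 1) * (Cρ * Cρ) + α * (3 * Cσ)) * ((KεG + CA * (KωN * (Real.exp (3 * δ / 8 + 3 * δ / 160) * (2 * CG) * B4Sect5Proof.latticeConst (d + 1) (3 * δ / 160)) + Kninv * Cρ * (2 * (CD + cAL ((d : ℝ) + 1) CD Cρ Cl Cσ α (B4Sect5Proof.latticeConst (d + 1) (δ / 8)) δ (δ / 8) * (2 * CG) * B4Sect5Proof.latticeConst (d + 1) (δ / 8)))) * B4Sect5Proof.latticeConst (d + 1) (3 * δ / 160) + KεA * (Cρ * Real.exp (3 * δ / 8 + 3 * δ / 160) * (2 * CG) * B4Sect5Proof.latticeConst (d + 1) (3 * δ / 160)) * B4Sect5Proof.latticeConst (d + 1) (3 * δ / 160) + CG * (KωVt * (2 *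 CG)) * B4Sect5Proof.latticeConst (d + 1) (3 * δ / 160) + KεG * (((d : ℝ) + 1) * Cl * (2 * CG)) * B4Sect5Proof.latticeConst (d + 1) (3 * δ / 160) + CA * (KωN * (2 * CG)) * B4Sect5Proof.latticeConst (d + 1) (3 * δ / 160) + KεA * (Cρ * (2 * CG)) * B4Sect5Proof.latticeConst (d + 1) (3 * δ / 160) + CG * (Kωm * (2 * CG)) * B4Sect5Proof.latticeConst (d + 1) (3 * δ / 160) + KεG * (((d : ℝ) + 1) * (Cρ * Cρ) * (2 * CG)) * B4Sect5Proof.latticeConst (d + 1) (3 * δ / 160) + CG * (KφQ * (2 * CG)) * B4Sect5Proof.latticeConst (d + 1) (3 * δ / 160) + KεG * (α * (3 * Cσ) * (2 * CG)) * B4Sect5Proof.latticeConst (d + 1) (3 * δ / 160)) * 2) + (KωV + Kωm + KφQ) * (2 * CG)) * B4Sect5Proof.latticeConst (d + 1) (3 * δ / 160) + (((d : ℝ) + 1) * Cρ * KεDb + ((d : ℝ) + 1) * KωN * CDb + ((d : ℝ) + 1) * Cρ * KεD + ((d : ℝ) + 1) * KωN * CD) * ((((d : ℝ) + 1) * Cl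 + ((d : ℝ) + 1) * (Cρ * Cρ) + α * (3 * Cσ)) * (2 * CG)) * B4Sect5Proof.latticeConst (d + 1) (3 * δ / 160) + (((d : ℝ) + 1) * Cρ * KεDb + ((d : ℝ) + 1) * KωN * CDb + ((d : ℝ) + 1) * Cρ * KεD + ((d : ℝ) + 1) * KωN * CD) * (((d : ℝ) + 1) * Cρ * Real.exp (3 * δ / 8 - 2 * (3 * δ / 160) + 3 * δ / 160) * (2 * (CD + cAL ((d : ℝ) + 1) CD Cρ Cl Cσ α (B4Sect5Proof.latticeConst (d + 1) (δ / 8)) δ (δ / 8) * (2 * CG) * B4Sect5Proof.latticeConst (d + 1) (δ / 8))) * B4Sect5Proof.latticeConst (d + 1) (3 * δ / 160) + ((d : ℝ) + 1) * Cρ * (2 * (CD + cAL ((d : ℝ) + 1) CD Cρ Cl Cσ α (B4Sect5Proof.latticeConst (d + 1) (δ / 8)) δ (δ / 8) * (2 * CG) * B4Sect5Proof.latticeConst (d + 1) (δ / 8)))) * B4Sect5Proof.latticeConst (d + 1) (3 * δ / 160)) * 2) * B4Sect5Proof.latticeConst (d + 1) (3 * δ / 160) + KεD * (((d : ℝ)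 + 1) * Cρ * Real.exp (3 * δ / 8 - 2 * (3 * δ / 160) + 3 * δ / 160) * (2 * (CD + cAL ((d : ℝ) + 1) CD Cρ Cl Cσ α (B4Sect5Proof.latticeConst (d + 1) (δ / 8)) δ (δ / 8) * (2 * CG) * B4Sect5Proof.latticeConst (d + 1) (δ / 8))) * B4Sect5Proof.latticeConst (d + 1) (3 * δ / 160) + ((d : ℝ) + 1) * Cρ * (2 * (CD + cAL ((d : ℝ) + 1) CD Cρ Cl Cσ α (B4Sect5Proof.latticeConst (d + 1) (δ / 8)) δ (δ / 8) * (2 * CG) * B4Sect5Proof.latticeConst (d + 1) (δ / 8)))) * B4Sect5Proof.latticeConst (d + 1) (3 * δ / 160)) * 2 + Cρ * Real.exp (3 * δ / 8 - 5 * (3 * δ / 160) + 3 * δ / 160) * (2 * CG * Kφt + (KεG + CA * (KωN * (Real.exp (3 * δ / 8 + 3 * δ / 160) * (2 * CG) * B4Sect5Proof.latticeConst (d + 1) (3 * δ / 160)) + Kninv * Cρ * (2 * (CD + cAL ((d : ℝ) + 1) CD Cρ Cl Cσ α (B4Sect5Proof.latticeConst (d + 1) (δ / 8)) δ (δ / 8)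 * (2 * CG) * B4Sect5Proof.latticeConst (d + 1) (δ / 8)))) * B4Sect5Proof.latticeConst (d + 1) (3 * δ / 160) + KεA * (Cρ * Real.exp (3 * δ / 8 + 3 * δ / 160) * (2 * CG) * B4Sect5Proof.latticeConst (d + 1) (3 * δ / 160)) * B4Sect5Proof.latticeConst (d + 1) (3 * δ / 160) + CG * (KωVt * (2 * CG)) * B4Sect5Proof.latticeConst (d + 1) (3 * δ / 160) + KεG * (((d : ℝ) + 1) * Cl * (2 * CG)) * B4Sect5Proof.latticeConst (d + 1) (3 * δ / 160) + CA * (KωN * (2 * CG)) * B4Sect5Proof.latticeConst (d + 1) (3 * δ / 160) + KεA * (Cρ * (2 * CG)) * B4Sect5Proof.latticeConst (d + 1) (3 * δ / 160) + CG * (Kωm * (2 * CG)) * B4Sect5Proof.latticeConst (d + 1) (3 * δ / 160) + KεG * (((d : ℝ) + 1) * (Cρ * Cρ) * (2 * CG)) * B4Sect5Proof.latticeConst (d + 1) (3 * δ / 160) + CG * (KφQ * (2 * CG)) * B4Sect5Proof.latticeConst (d + 1) (3 * δ / 160) + KεG * (α * (3 * Cσ) * (2 * CG)) * B4Sect5Proof.latticeConst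 (d + 1) (3 * δ / 160)) * 2 * 2) * B4Sect5Proof.latticeConst (d + 1) (3 * δ / 160) + KωN * (Real.exp (3 * δ / 8 - 5 * (3 * δ / 160) + 3 * δ / 160) * (2 * CG) * B4Sect5Proof.latticeConst (d + 1) (3 * δ / 160)) * 2 + Kninv * Cρ * (2 * (CD + cAL ((d : ℝ) + 1) CD Cρ Cl Cσ α (B4Sect5Proof.latticeConst (d + 1) (δ / 8)) δ (δ / 8) * (2 * CG) * B4Sect5Proof.latticeConst (d + 1) (δ / 8))) * 2)) * B4Sect5Proof.latticeConst (d + 1) (3 * δ / 160)) * B4Sect5Proof.latticeConst (d + 1) (3 * δ / 160) + (CD + cPL ((d : ℝ) + 1) CG CD Cρ Cl Cσ α (B4Sect5Proof.latticeConst (d + 1) (δ / 8)) δ (δ / 8)) * 2 * (2 * CS * (2 * CS) * ((Fintype.card ι * (2 * CG * 2) * (2 * CG * Kφt + (KεG + CA * (KωN * (Real.exp (3 * δ / 8 + 3 * δ / 160) * (2 * CG) * B4Sect5Proof.latticeConst (d + 1) (3 * δ / 160)) + Kninv * Cρ * (2 * (CD + cAL ((d : ℝ) + 1) CD Cρ Cl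 Cσ α (B4Sect5Proof.latticeConst (d + 1) (δ / 8)) δ (δ / 8) * (2 * CG) * B4Sect5Proof.latticeConst (d + 1) (δ / 8)))) * B4Sect5Proof.latticeConst (d + 1) (3 * δ / 160) + KεA * (Cρ * Real.exp (3 * δ / 8 + 3 * δ / 160) * (2 * CG) * B4Sect5Proof.latticeConst (d + 1) (3 * δ / 160)) * B4Sect5Proof.latticeConst (d + 1) (3 * δ / 160) + CG * (KωVt * (2 * CG)) * B4Sect5Proof.latticeConst (d + 1) (3 * δ / 160) + KεG * (((d : ℝ) + 1) * Cl * (2 * CG)) * B4Sect5Proof.latticeConst (d + 1) (3 * δ / 160) + CA * (KωN * (2 * CG)) * B4Sect5Proof.latticeConst (d + 1) (3 * δ / 160) + KεA * (Cρ * (2 * CG)) * B4Sect5Proof.latticeConst (d + 1) (3 * δ / 160) + CG * (Kωm * (2 * CG)) * B4Sect5Proof.latticeConst (d + 1) (3 * δ / 160) + KεG * (((d : ℝ) + 1) * (Cρ * Cρ) * (2 * CG)) * B4Sect5Proof.latticeConst (d + 1) (3 * δ / 160) + CG * (KφQ * (2 * CG)) * B4Sect5Proof.latticeConst (d + 1)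 (3 * δ / 160) + KεG * (α * (3 * Cσ) * (2 * CG)) * B4Sect5Proof.latticeConst (d + 1) (3 * δ / 160)) * 2 * 2) + Fintype.card ι * (2 * CG * Kφt + (KεG + CA * (KωN * (Real.exp (3 * δ / 8 + 3 * δ / 160) * (2 * CG) * B4Sect5Proof.latticeConst (d + 1) (3 * δ / 160)) + Kninv * Cρ * (2 * (CD + cAL ((d : ℝ) + 1) CD Cρ Cl Cσ α (B4Sect5Proof.latticeConst (d + 1) (δ / 8)) δ (δ / 8) * (2 * CG) * B4Sect5Proof.latticeConst (d + 1) (δ / 8)))) * B4Sect5Proof.latticeConst (d + 1) (3 * δ / 160) + KεA * (Cρ * Real.exp (3 * δ / 8 + 3 * δ / 160) * (2 * CG) * B4Sect5Proof.latticeConst (d + 1) (3 * δ / 160)) * B4Sect5Proof.latticeConst (d + 1) (3 * δ / 160) + CG * (KωVt * (2 * CG)) * B4Sect5Proof.latticeConst (d + 1) (3 * δ / 160) + KεG * (((d : ℝ) + 1) * Cl * (2 * CG)) * B4Sect5Proof.latticeConst (d + 1) (3 * δ / 160) + CA * (KωN * (2 * CG)) * B4Sect5Proof.latticeConst (d + 1)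 (3 * δ / 160) + KεA * (Cρ * (2 * CG)) * B4Sect5Proof.latticeConst (d + 1) (3 * δ / 160) + CG * (Kωm * (2 * CG)) * B4Sect5Proof.latticeConst (d + 1) (3 * δ / 160) + KεG * (((d : ℝ) + 1) * (Cρ * Cρ) * (2 * CG)) * B4Sect5Proof.latticeConst (d + 1) (3 * δ / 160) + CG * (KφQ * (2 * CG)) * B4Sect5Proof.latticeConst (d + 1) (3 * δ / 160) + KεG * (α * (3 * Cσ) * (2 * CG)) * B4Sect5Proof.latticeConst (d + 1) (3 * δ / 160)) * 2 * 2) * (2 * CG * 2)) * B4Sect5Proof.latticeConst (d + 1) (3 * δ / 160)) * B4Sect5Proof.latticeConst (d + 1) (3 * δ / 160) * B4Sect5Proof.latticeConst (d + 1) (3 * δ / 160) * (((d : ℝ) + 1) * Fintype.card ι * ((CD + cPL ((d : ℝ) + 1) CG CD Cρ Cl Cσ α (B4Sect5Proof.latticeConst (d + 1) (δ / 8)) δ (δ / 8)) * 2)) * B4Sect5Proof.latticeConst (d + 1) (3 * δ / 160)) * B4Sect5Proof.latticeConst (d + 1) (3 * δ / 160) + (2 * (CD + cAL ((d : ℝ)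 + 1) CD Cρ Cl Cσ α (B4Sect5Proof.latticeConst (d + 1) (δ / 8)) δ (δ / 8) * (2 * CG) * B4Sect5Proof.latticeConst (d + 1) (δ / 8)) * Kφt + (KεD + CD * ((((d : ℝ) + 1) * Cl + ((d : ℝ) + 1) * (Cρ * Cρ) + α * (3 * Cσ)) * ((KεG + CA * (KωN * (Real.exp (3 * δ / 8 + 3 * δ / 160) * (2 * CG) * B4Sect5Proof.latticeConst (d + 1) (3 * δ / 160)) + Kninv * Cρ * (2 * (CD + cAL ((d : ℝ) + 1) CD Cρ Cl Cσ α (B4Sect5Proof.latticeConst (d + 1) (δ / 8)) δ (δ / 8) * (2 * CG) * B4Sect5Proof.latticeConst (d + 1) (δ / 8)))) * B4Sect5Proof.latticeConst (d + 1) (3 * δ / 160) + KεA * (Cρ * Real.exp (3 * δ / 8 + 3 * δ / 160) * (2 * CG) * B4Sect5Proof.latticeConst (d + 1) (3 * δ / 160)) * B4Sect5Proof.latticeConst (d + 1) (3 * δ / 160) + CG * (KωVt * (2 * CG)) * B4Sect5Proof.latticeConst (d + 1) (3 * δ / 160) + KεG * (((d : ℝ) + 1) * Cl * (2 * CG)) *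 B4Sect5Proof.latticeConst (d + 1) (3 * δ / 160) + CA * (KωN * (2 * CG)) * B4Sect5Proof.latticeConst (d + 1) (3 * δ / 160) + KεA * (Cρ * (2 * CG)) * B4Sect5Proof.latticeConst (d + 1) (3 * δ / 160) + CG * (Kωm * (2 * CG)) * B4Sect5Proof.latticeConst (d + 1) (3 * δ / 160) + KεG * (((d : ℝ) + 1) * (Cρ * Cρ) * (2 * CG)) * B4Sect5Proof.latticeConst (d + 1) (3 * δ / 160) + CG * (KφQ * (2 * CG)) * B4Sect5Proof.latticeConst (d + 1) (3 * δ / 160) + KεG * (α * (3 * Cσ) * (2 * CG)) * B4Sect5Proof.latticeConst (d + 1) (3 * δ / 160)) * 2) + (KωV + Kωm + KφQ) * (2 * CG)) * B4Sect5Proof.latticeConst (d + 1) (3 * δ / 160) + KεD * ((((d : ℝ) + 1) * Cl + ((d : ℝ) + 1) * (Cρ * Cρ) + α * (3 * Cσ)) * (2 * CG)) * B4Sect5Proof.latticeConst (d + 1) (3 * δ / 160) + CD * ((((d : ℝ) + 1) * Cρ * KεDb + ((d : ℝ) + 1) * KωN * CDb + ((d : ℝ) + 1) * Cρ * KεD +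 ((d : ℝ) + 1) * KωN * CD + ((d : ℝ) + 1) * Cρ * (CDb + CD) * ((((d : ℝ) + 1) * Cl + ((d : ℝ) + 1) * (Cρ * Cρ) + α * (3 * Cσ)) * ((KεG + CA * (KωN * (Real.exp (3 * δ / 8 + 3 * δ / 160) * (2 * CG) * B4Sect5Proof.latticeConst (d + 1) (3 * δ / 160)) + Kninv * Cρ * (2 * (CD + cAL ((d : ℝ) + 1) CD Cρ Cl Cσ α (B4Sect5Proof.latticeConst (d + 1) (δ / 8)) δ (δ / 8) * (2 * CG) * B4Sect5Proof.latticeConst (d + 1) (δ / 8)))) * B4Sect5Proof.latticeConst (d + 1) (3 * δ / 160) + KεA * (Cρ * Real.exp (3 * δ / 8 + 3 * δ / 160) * (2 * CG) * B4Sect5Proof.latticeConst (d + 1) (3 * δ / 160)) * B4Sect5Proof.latticeConst (d + 1) (3 * δ / 160) + CG * (KωVt * (2 * CG)) * B4Sect5Proof.latticeConst (d + 1) (3 * δ / 160) + KεG * (((d : ℝ) + 1) * Cl * (2 * CG)) * B4Sect5Proof.latticeConst (d + 1) (3 * δ / 160) + CA * (KωN * (2 * CG)) * B4Sect5Proof.latticeConst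 (d + 1) (3 * δ / 160) + KεA * (Cρ * (2 * CG)) * B4Sect5Proof.latticeConst (d + 1) (3 * δ / 160) + CG * (Kωm * (2 * CG)) * B4Sect5Proof.latticeConst (d + 1) (3 * δ / 160) + KεG * (((d : ℝ) + 1) * (Cρ * Cρ) * (2 * CG)) * B4Sect5Proof.latticeConst (d + 1) (3 * δ / 160) + CG * (KφQ * (2 * CG)) * B4Sect5Proof.latticeConst (d + 1) (3 * δ / 160) + KεG * (α * (3 * Cσ) * (2 * CG)) * B4Sect5Proof.latticeConst (d + 1) (3 * δ / 160)) * 2) + (KωV + Kωm + KφQ) * (2 * CG)) * B4Sect5Proof.latticeConst (d + 1) (3 * δ / 160) + (((d : ℝ) + 1) * Cρ * KεDb + ((d : ℝ) + 1) * KωN * CDb + ((d : ℝ) + 1) * Cρ * KεD + ((d : ℝ) + 1) * KωN * CD) * ((((d : ℝ) + 1) * Cl + ((d : ℝ) + 1) * (Cρ * Cρ) + α * (3 * Cσ)) * (2 * CG)) * B4Sect5Proof.latticeConst (d + 1) (3 * δ / 160) + (((d : ℝ) + 1) * Cρ * KεDb + ((d : ℝ) + 1) * KωN * CDb + ((d :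 ℝ) + 1) * Cρ * KεD + ((d : ℝ) + 1) * KωN * CD) * (((d : ℝ) + 1) * Cρ * Real.exp (3 * δ / 8 - 2 * (3 * δ / 160) + 3 * δ / 160) * (2 * (CD + cAL ((d : ℝ) + 1) CD Cρ Cl Cσ α (B4Sect5Proof.latticeConst (d + 1) (δ / 8)) δ (δ / 8) * (2 * CG) * B4Sect5Proof.latticeConst (d + 1) (δ / 8))) * B4Sect5Proof.latticeConst (d + 1) (3 * δ / 160) + ((d : ℝ) + 1) * Cρ * (2 * (CD + cAL ((d : ℝ) + 1) CD Cρ Cl Cσ α (B4Sect5Proof.latticeConst (d + 1) (δ / 8)) δ (δ / 8) * (2 * CG) * B4Sect5Proof.latticeConst (d + 1) (δ / 8)))) * B4Sect5Proof.latticeConst (d + 1) (3 * δ / 160)) * 2) * B4Sect5Proof.latticeConst (d + 1) (3 * δ / 160) + KεD * (((d : ℝ) + 1) * Cρ * Real.exp (3 * δ / 8 - 2 * (3 * δ / 160) + 3 * δ / 160) * (2 * (CD + cAL ((d : ℝ) + 1) CD Cρ Cl Cσ α (B4Sect5Proof.latticeConst (d + 1) (δ / 8)) δ (δ / 8) * (2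 * CG) * B4Sect5Proof.latticeConst (d + 1) (δ / 8))) * B4Sect5Proof.latticeConst (d + 1) (3 * δ / 160) + ((d : ℝ) + 1) * Cρ * (2 * (CD + cAL ((d : ℝ) + 1) CD Cρ Cl Cσ α (B4Sect5Proof.latticeConst (d + 1) (δ / 8)) δ (δ / 8) * (2 * CG) * B4Sect5Proof.latticeConst (d + 1) (δ / 8)))) * B4Sect5Proof.latticeConst (d + 1) (3 * δ / 160)) * 2 + Cρ * Real.exp (3 * δ / 8 - 5 * (3 * δ / 160) + 3 * δ / 160) * (2 * CG * Kφt + (KεG + CA * (KωN * (Real.exp (3 * δ / 8 + 3 * δ / 160) * (2 * CG) * B4Sect5Proof.latticeConst (d + 1) (3 * δ / 160)) + Kninv * Cρ * (2 * (CD + cAL ((d : ℝ) + 1) CD Cρ Cl Cσ α (B4Sect5Proof.latticeConst (d + 1) (δ / 8)) δ (δ / 8) * (2 * CG) * B4Sect5Proof.latticeConst (d + 1) (δ / 8)))) * B4Sect5Proof.latticeConst (d + 1) (3 * δ / 160) + KεA * (Cρ * Real.exp (3 * δ / 8 + 3 * δ / 160) * (2 * CG) * B4Sect5Proof.latticeConst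 (d + 1) (3 * δ / 160)) * B4Sect5Proof.latticeConst (d + 1) (3 * δ / 160) + CG * (KωVt * (2 * CG)) * B4Sect5Proof.latticeConst (d + 1) (3 * δ / 160) + KεG * (((d : ℝ) + 1) * Cl * (2 * CG)) * B4Sect5Proof.latticeConst (d + 1) (3 * δ / 160) + CA * (KωN * (2 * CG)) * B4Sect5Proof.latticeConst (d + 1) (3 * δ / 160) + KεA * (Cρ * (2 * CG)) * B4Sect5Proof.latticeConst (d + 1) (3 * δ / 160) + CG * (Kωm * (2 * CG)) * B4Sect5Proof.latticeConst (d + 1) (3 * δ / 160) + KεG * (((d : ℝ) + 1) * (Cρ * Cρ) * (2 * CG)) * B4Sect5Proof.latticeConst (d + 1) (3 * δ / 160) + CG * (KφQ * (2 * CG)) * B4Sect5Proof.latticeConst (d + 1) (3 * δ / 160) + KεG * (α * (3 * Cσ) * (2 * CG)) * B4Sect5Proof.latticeConst (d + 1) (3 * δ / 160)) * 2 * 2) * B4Sect5Proof.latticeConst (d + 1) (3 * δ / 160) + KωN * (Real.exp (3 * δ / 8 - 5 * (3 * δ / 160) + 3 * δ / 160) * (2 * CG) * B4Sect5Proof.latticeConst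 (d + 1) (3 * δ / 160)) * 2 + Kninv * Cρ * (2 * (CD + cAL ((d : ℝ) + 1) CD Cρ Cl Cσ α (B4Sect5Proof.latticeConst (d + 1) (δ / 8)) δ (δ / 8) * (2 * CG) * B4Sect5Proof.latticeConst (d + 1) (δ / 8))) * 2) * (2 * CS * (((d : ℝ) + 1) * Fintype.card ι * ((CD + cPL ((d : ℝ) + 1) CG CD Cρ Cl Cσ α (B4Sect5Proof.latticeConst (d + 1) (δ / 8)) δ (δ / 8)) * 2)) * B4Sect5Proof.latticeConst (d + 1) (3 * δ / 160)) * B4Sect5Proof.latticeConst (d + 1) (3 * δ / 160) + (CD * (CS * (((d : ℝ) + 1) * Fintype.card ι * KεD) * B4Sect5Proof.latticeConst (d + 1) (3 * δ / 160)) * B4Sect5Proof.latticeConst (d + 1) (3 * δ / 160) + CD * (CS * CS * ((Fintype.card ι * CG * KεG + Fintype.card ι * KεG * CG) * B4Sect5Proof.latticeConst (d + 1) (3 * δ / 160)) * B4Sect5Proof.latticeConst (d + 1) (3 * δ / 160) * B4Sect5Proof.latticeConst (d + 1) (3 * δ / 160) * (((d : ℝ) + 1) * Fintype.card ι * CD)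 * B4Sect5Proof.latticeConst (d + 1) (3 * δ / 160)) * B4Sect5Proof.latticeConst (d + 1) (3 * δ / 160) + KεD * (CS * (((d : ℝ) + 1) * Fintype.card ι * CD) * B4Sect5Proof.latticeConst (d + 1) (3 * δ / 160)) * B4Sect5Proof.latticeConst (d + 1) (3 * δ / 160))) * Real.exp (-((3 * δ / 16) * tdistT M y y'))) := by
  have hLpos : 0 < L := Nat.pos_of_ne_zero (NeZero.ne L)
  have hn0 : (0 : ℝ) < (((L ^ k : ℕ) : ℝ)) := by exact_mod_cast pow_pos hLpos k
  have hn'0 : (0 : ℝ) < (((L ^ m * L ^ k : ℕ) : ℝ)) := by exact_mod_cast Nat.mul_pos (pow_pos hLpos m) (pow_pos hLpos k)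
  have hd := unitTorusGeo_dist_nonneg L k M
  have hD0 : (0 : ℝ) ≤ ((d : ℝ) + 1) := by positivity
  have h2CG : (0 : ℝ) ≤ (2 * CG) := by positivity
  have hc8 : 0 ≤ (B4Sect5Proof.latticeConst (d + 1) (δ / 8)) := B4Sect5Proof.latticeConst_nonneg (d + 1) (by positivity)
  have hKA : 0 ≤ cAL ((d : ℝ) + 1) CD Cρ Cl Cσ α (B4Sect5Proof.latticeConst (d + 1) (δ / 8)) δ (δ / 8) := by unfold cAL; positivity
  have hKP : 0 ≤ cPL ((d : ℝ) + 1) CG CD Cρ Cl Cσ α (B4Sect5Proof.latticeConst (d + 1) (δ / 8)) δ (δ / 8) := by unfold cPL cAL cYL; positivity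
  have hCY0 : 0 ≤ (2 * (CD + cAL ((d : ℝ) + 1) CD Cρ Cl Cσ α (B4Sect5Proof.latticeConst (d + 1) (δ / 8)) δ (δ / 8) * (2 * CG) * (B4Sect5Proof.latticeConst (d + 1) (δ / 8)))) := by positivity
  have hCDTle : (CD + cPL ((d : ℝ) + 1) CG CD Cρ Cl Cσ α (B4Sect5Proof.latticeConst (d + 1) (δ / 8)) δ (δ / 8) * r) ≤ CD + cPL ((d : ℝ) + 1) CG CD Cρ Cl Cσ α (B4Sect5Proof.latticeConst (d + 1) (δ / 8)) δ (δ / 8) := add_le_add le_rfl (mul_le_of_le_one_right hKP hr1)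
  -- the four `T`-rows on both grids (n15-c∕252)
  obtain ⟨hX, hY, hDT, hSi⟩ := tRows_of_flat'' M (L ^ k) L k hT ha hδ hCG hCA hCD hCS hCρ hCl hCσ hα hr0 hr1 hρ0 hlam0 hσ0 haα hρr hρc hlamr hlamc hσr hσc hnρ hnlam hσle hG1 hA1 hD1 hS1 hsmallL hsmall
  obtain ⟨hX', hY', hDT', hSi'⟩ := tRows_of_flat'' M (L ^ m * L ^ k) L k hT' ha' hδ hCG hCA hCD hCS hCρ hCl hCσ hα hr0 hr1 hρ₁0 hlam₁0 hσ₁0 haα' hρr' hρc' hlamr' hlamc' hσr' hσc' hnρ' hnlam' hσle' hG1' hA1' hD1' hS1' hsmallL hsmall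
  -- staircase letters `τ = 1 + σ`
  have e1 : ∀ (y : Tor M) (aa : Fin (d + 1) → Fin (L ^ k)), cvaStair M (L ^ k) (fun μ (b : Tor (fine (L ^ k) M) × Fin (d + 1)) => (fun (_ : Fin (d + 1)) (_ : Tor (fine (L ^ k) M)) => (1 : Matrix ι ι ℝ)) μ b.1) y aa 0 = 1 := fun y aa => cvaStair_one M (L ^ k) y aa 0
  have e1' : ∀ (y : Tor M) (aa : Fin (d + 1) → Fin (L ^ m * L ^ k)), cvaStair M (L ^ m * L ^ k) (fun μ (b : Tor (fine (L ^ m * L ^ k) M) × Fin (d + 1)) => (fun (_ : Fin (d + 1)) (_ : Tor (fine (L ^ m * L ^ k) M)) => (1 : Matrix ι ι ℝ)) μ b.1) y aa 0 = 1 := fun y aa => cvaStair_one M (L ^ m * L ^ k) y aa 0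
  have hτr : ∀ y aa i, ∑ j, |cvaStair M (L ^ k) (fun μ b => T μ b.1) y aa 0 i j| ≤ 1 + σ := fun y aa i =>
    rows_le_of_rows_sub_one (A := cvaStair M (L ^ k) (fun μ b => T μ b.1) y aa 0) (fun i' => by have h := hσr y aa i'; rwa [e1] at h) i
  have hτc : ∀ y aa i, ∑ j, |cvaStair M (L ^ k) (fun μ b => T μ b.1) y aa 0 j i| ≤ 1 + σ := fun y aa i =>
    cols_le_of_cols_sub_one (A := cvaStair M (L ^ k) (fun μ b => T μ b.1) y aa 0) (fun j' => by have h := hσc y aa j'; rwa [e1] at h) i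
  have hτr' : ∀ y aa i, ∑ j, |cvaStair M (L ^ m * L ^ k) (fun μ b => T' μ b.1) y aa 0 i j| ≤ 1 + σ₁ := fun y aa i =>
    rows_le_of_rows_sub_one (A := cvaStair M (L ^ m * L ^ k) (fun μ b => T' μ b.1) y aa 0) (fun i' => by have h := hσr' y aa i'; rwa [e1'] at h) i
  have hτc' : ∀ y aa i, ∑ j, |cvaStair M (L ^ m * L ^ k) (fun μ b => T' μ b.1) y aa 0 j i| ≤ 1 + σ₁ := fun y aa i =>
    cols_le_of_cols_sub_one (A := cvaStair M (L ^ m * L ^ k) (fun μ b => T' μ b.1) y aa 0) (fun j' => by have h := hσc' y aa j'; rwa [e1'] at h) i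
  have hτ0 : (0 : ℝ) ≤ 1 + σ := by positivity
  have hτ0' : (0 : ℝ) ≤ 1 + σ₁ := by positivity
  -- `σ ≤ 1`, hence `τ ≤ 2`; the r-free letter bounds
  obtain ⟨c8, hc8def⟩ : ∃ x : ℝ, x = (B4Sect5Proof.latticeConst (d + 1) (δ / 8)) := ⟨_, rfl⟩
  obtain ⟨KX, hKXdef⟩ : ∃ x : ℝ, x = cXL ((d : ℝ) + 1) CG CA Cρ Cl Cσ α c8 δ (δ / 8) := ⟨_, rfl⟩
  obtain ⟨KY, hKYdef⟩ : ∃ x : ℝ, x = cYL ((d : ℝ) + 1) CD Cρ c8 δ := ⟨_, rfl⟩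
  have hc8' : 0 ≤ c8 := by rw [hc8def]; exact hc8
  have hXc0 : 0 ≤ 2 * KX * c8 := by rw [hKXdef]; unfold cXL; positivity
  have hYc0 : 0 ≤ 2 * KY * c8 := by rw [hKYdef]; unfold cYL; positivity
  have hsm' : (2 * KX * c8 + 2 * KY * c8 + Cσ) * r ≤ 1 := by rw [hKXdef, hKYdef, hc8def]; exact hsmallL
  have hCσ1 : Cσ * r ≤ 1 := by nlinarith only [hsm', hXc0, hYc0, hCσ, hr0]
  have hσ1 : σ ≤ 1 := hσle.trans hCσ1
  have hσ1' : σ₁ ≤ 1 := hσle'.trans hCσ1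
  have hτ2 : 1 + σ ≤ 2 := by linarith only [hσ1]
  have hτ2' : 1 + σ₁ ≤ 2 := by linarith only [hσ1']
  have hCρr : Cρ * r ≤ Cρ := mul_le_of_le_one_right hCρ hr1
  have hClr : Cl * r ≤ Cl := mul_le_of_le_one_right hCl hr1
  have hCσr : Cσ * r ≤ Cσ := mul_le_of_le_one_right hCσ hr1
  have hn1 : (((L ^ k : ℕ) : ℝ)) * ρ ≤ Cρ := hnρ.trans hCρr
  have hn1' : (((L ^ m * L ^ k : ℕ) : ℝ)) * ρ₁ ≤ Cρ := hnρ'.trans hCρr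
  have hl1 : (((L ^ k : ℕ) : ℝ)) * ((((L ^ k : ℕ) : ℝ)) * lam) ≤ Cl := hnlam.trans hClr
  have hl1' : (((L ^ m * L ^ k : ℕ) : ℝ)) * ((((L ^ m * L ^ k : ℕ) : ℝ)) * lam₁) ≤ Cl := hnlam'.trans hClr
  have hσ3 : σ * (1 + σ) + σ ≤ 3 * Cσ := by
    have t : σ * (1 + σ) ≤ σ * 2 := mul_le_mul_of_nonneg_left hτ2 hσ0
    linarith only [t, hσle, hCσr]
  have hσ3' : σ₁ * (1 + σ₁) + σ₁ ≤ 3 * Cσ := by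
    have t : σ₁ * (1 + σ₁) ≤ σ₁ * 2 := mul_le_mul_of_nonneg_left hτ2' hσ₁0
    linarith only [t, hσle', hCσr]
  have hDρ : (((L ^ k : ℕ) : ℝ)) * (((d + 1 : ℕ) : ℝ) * ρ) ≤ ((d : ℝ) + 1) * Cρ := by
    calc (((L ^ k : ℕ) : ℝ)) * (((d + 1 : ℕ) : ℝ) * ρ) = ((d : ℝ) + 1) * ((((L ^ k : ℕ) : ℝ)) * ρ) := by push_cast; ring
      _ ≤ ((d : ℝ) + 1) * Cρ := mul_le_mul_of_nonneg_left hn1 hD0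
  have hDρ' : (((L ^ m * L ^ k : ℕ) : ℝ)) * (((d + 1 : ℕ) : ℝ) * ρ₁) ≤ ((d : ℝ) + 1) * Cρ := by
    calc (((L ^ m * L ^ k : ℕ) : ℝ)) * (((d + 1 : ℕ) : ℝ) * ρ₁) = ((d : ℝ) + 1) * ((((L ^ m * L ^ k : ℕ) : ℝ)) * ρ₁) := by push_cast; ring
      _ ≤ ((d : ℝ) + 1) * Cρ := mul_le_mul_of_nonneg_left hn1' hD0
  have hLET : ((d : ℝ) + 1) * (((L ^ k : ℕ) : ℝ)) * ((((L ^ k : ℕ) : ℝ)) * lam) + ((d : ℝ) + 1) * ((((L ^ k : ℕ) : ℝ)) * ρ * ((((L ^ k : ℕ) : ℝ)) * ρ)) + |a| * (((((L ^ k : ℕ) : ℝ)) ^ (d + 1))⁻¹ * (σ * (1 + σ) + σ)) ≤ ((d : ℝ) + 1) * Cl + ((d : ℝ) + 1) * (Cρ * Cρ) + α * (3 * Cσ) := by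
    refine add_le_add (add_le_add ?_ ?_) ?_
    · rw [mul_assoc]; exact mul_le_mul_of_nonneg_left hl1 hD0
    · exact mul_le_mul_of_nonneg_left (mul_le_mul hn1 hn1 (by positivity) hCρ) hD0
    · rw [← mul_assoc]; exact mul_le_mul haα hσ3 (by positivity) hα
  have hLET' : ((d : ℝ) + 1) * (((L ^ m * L ^ k : ℕ) : ℝ)) * ((((L ^ m * L ^ k : ℕ) : ℝ)) * lam₁) + ((d : ℝ) + 1) * ((((L ^ m * L ^ k : ℕ) : ℝ)) * ρ₁ * ((((L ^ m * L ^ k : ℕ) : ℝ)) * ρ₁)) + |a'| * (((((L ^ m * L ^ k : ℕ) : ℝ)) ^ (d + 1))⁻¹ * (σ₁ * (1 + σ₁) + σ₁)) ≤ ((d : ℝ) + 1) * Cl + ((d : ℝ) + 1) * (Cρ * Cρ) + α * (3 * Cσ) := by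
    refine add_le_add (add_le_add ?_ ?_) ?_
    · rw [mul_assoc]; exact mul_le_mul_of_nonneg_left hl1' hD0
    · exact mul_le_mul_of_nonneg_left (mul_le_mul hn1' hn1' (by positivity) hCρ) hD0
    · rw [← mul_assoc]; exact mul_le_mul haα' hσ3' (by positivity) hα
  -- the rate data of n15-c∕242 (`δ₂ = 3δ/8`, `s₂ = 3δ/160`)
  have hs2 : 0 < (3 * δ / 160) := by positivity
  have hsδ2 : 10 * (3 * δ / 160) ≤ (3 * δ / 8) := by linarith
  have hrow2 : RowSum (unitTorusGeo L k M) (3 * δ / 160) (B4Sect5Proof.latticeConst (d + 1) (3 * δ / 160)) := rowSum_unitTorusGeo L k M hs2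
  have hc2 : 0 ≤ (B4Sect5Proof.latticeConst (d + 1) (3 * δ / 160)) := B4Sect5Proof.latticeConst_nonneg (d + 1) hs2.le
  have hr38 : (3 * δ / 8) ≤ δ := by linarith
  -- the fine Neumann steps: `θ′·c₂ ≤ ½`, `((d+1)(n′ρ′)(C_D̄ + C_D))·c₂ ≤ ½`
  have hee' : ((((L ^ m * L ^ k : ℕ) : ℝ)) * (((d + 1 : ℕ) : ℝ) * ρ₁) * Real.exp ((3 * δ / 8) + (3 * δ / 160))) * ((((L ^ m * L ^ k : ℕ) : ℝ)) * ρ₁ * Real.exp ((3 * δ / 8) + (3 * δ / 160))) * (B4Sect5Proof.latticeConst (d + 1) (3 * δ / 160)) ≤ ((((d : ℝ) + 1) * Cρ * Real.exp ((3 * δ / 8) + (3 * δ / 160))) * (Cρ * Real.exp ((3 * δ / 8) + (3 * δ / 160))) * (B4Sect5Proof.latticeConst (d + 1) (3 * δ / 160))) * r := by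
    have t1 : (((L ^ m * L ^ k : ℕ) : ℝ)) * (((d + 1 : ℕ) : ℝ) * ρ₁) * Real.exp ((3 * δ / 8) + (3 * δ / 160)) ≤ ((d : ℝ) + 1) * Cρ * Real.exp ((3 * δ / 8) + (3 * δ / 160)) := mul_le_mul_of_nonneg_right hDρ' (Real.exp_pos _).le
    have t2 : (((L ^ m * L ^ k : ℕ) : ℝ)) * ρ₁ * Real.exp ((3 * δ / 8) + (3 * δ / 160)) ≤ Cρ * r * Real.exp ((3 * δ / 8) + (3 * δ / 160)) := mul_le_mul_of_nonneg_right hnρ' (Real.exp_pos _).le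
    calc _ ≤ (((d : ℝ) + 1) * Cρ * Real.exp ((3 * δ / 8) + (3 * δ / 160))) * (Cρ * r * Real.exp ((3 * δ / 8) + (3 * δ / 160))) * (B4Sect5Proof.latticeConst (d + 1) (3 * δ / 160)) := by gcongr
      _ = _ := by ring
  have hθK' : (CA * (((L ^ m * L ^ k : ℕ) : ℝ) * ρ₁ * Real.exp (3 * δ / 8)) * B4Sect5Proof.latticeConst (d + 1) (3 * δ / 160) + CG * (((d : ℝ) + 1) * ((L ^ m * L ^ k : ℕ) : ℝ) * (((L ^ m * L ^ k : ℕ) : ℝ) * lam₁)) + CA * (((L ^ m * L ^ k : ℕ) : ℝ) * ρ₁) + CG * (((L ^ m * L ^ k : ℕ) : ℝ) * ((d + 1 : ℕ) * ρ₁) * Real.exp (3 * δ / 8 + 3 * δ / 160) * (((L ^ m * L ^ k : ℕ) : ℝ) * ρ₁ * Real.exp (3 * δ / 8 + 3 * δ / 160)) * B4Sect5Proof.latticeConst (d + 1) (3 * δ / 160)) * B4Sect5Proof.latticeConst (d + 1) (3 * δ / 160) + |a'| * ((((L ^ m * L ^ k : ℕ) : ℝ) ^ (d + 1))⁻¹ *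 CG * (σ₁ * (1 + σ₁) + σ₁))) ≤ cXL ((d : ℝ) + 1) CG CA Cρ Cl Cσ α (B4Sect5Proof.latticeConst (d + 1) (3 * δ / 160)) (3 * δ / 8) (3 * δ / 160) * r := by
    have h1 : CA * ((((L ^ m * L ^ k : ℕ) : ℝ)) * ρ₁ * Real.exp (3 * δ / 8)) * (B4Sect5Proof.latticeConst (d + 1) (3 * δ / 160)) ≤ CA * (Cρ * r * Real.exp (3 * δ / 8)) * (B4Sect5Proof.latticeConst (d + 1) (3 * δ / 160)) := by gcongr
    have h2 : CG * (((d : ℝ) + 1) * (((L ^ m * L ^ k : ℕ) : ℝ)) * ((((L ^ m * L ^ k : ℕ) : ℝ)) * lam₁)) ≤ CG * (((d : ℝ) + 1) * (Cl * r)) := by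
      rw [mul_assoc ((d : ℝ) + 1)]; exact mul_le_mul_of_nonneg_left (mul_le_mul_of_nonneg_left hnlam' hD0) hCG
    have h3 : CA * ((((L ^ m * L ^ k : ℕ) : ℝ)) * ρ₁) ≤ CA * (Cρ * r) := mul_le_mul_of_nonneg_left hnρ' hCA
    have h4 : CG * (((((L ^ m * L ^ k : ℕ) : ℝ)) * (((d + 1 : ℕ) : ℝ) * ρ₁) * Real.exp ((3 * δ / 8) + (3 * δ / 160))) * ((((L ^ m * L ^ k : ℕ) : ℝ)) * ρ₁ * Real.exp ((3 * δ / 8) + (3 * δ / 160))) * (B4Sect5Proof.latticeConst (d + 1) (3 * δ / 160))) * (B4Sect5Proof.latticeConst (d + 1) (3 * δ / 160)) ≤ CG * (((((d : ℝ) + 1) * Cρ * Real.exp ((3 * δ / 8) + (3 * δ / 160))) * (Cρ * Real.exp ((3 * δ / 8) + (3 * δ / 160))) * (B4Sect5Proof.latticeConst (d + 1) (3 * δ / 160))) * r) * (B4Sect5Proof.latticeConst (d + 1) (3 * δ / 160)) :=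
      mul_le_mul_of_nonneg_right (mul_le_mul_of_nonneg_left hee' hCG) hc2
    have h50 : σ₁ * (1 + σ₁) + σ₁ ≤ 3 * (Cσ * r) := by
      have t : σ₁ * (1 + σ₁) ≤ σ₁ * 2 := mul_le_mul_of_nonneg_left hτ2' hσ₁0
      linarith only [t, hσle']
    have h5 : |a'| * (((((L ^ m * L ^ k : ℕ) : ℝ)) ^ (d + 1))⁻¹ * CG * (σ₁ * (1 + σ₁) + σ₁)) ≤ α * (CG * (3 * (Cσ * r))) := by
      calc |a'| * (((((L ^ m * L ^ k : ℕ) : ℝ)) ^ (d + 1))⁻¹ * CG * (σ₁ * (1 + σ₁) + σ₁)) = (|a'| * ((((L ^ m * L ^ k : ℕ) : ℝ)) ^ (d + 1))⁻¹) * (CG * (σ₁ * (1 + σ₁) + σ₁)) := by ring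
        _ ≤ α * (CG * (3 * (Cσ * r))) := mul_le_mul haα' (mul_le_mul_of_nonneg_left h50 hCG) (by positivity) hα
    calc _ ≤ CA * (Cρ * r * Real.exp (3 * δ / 8)) * (B4Sect5Proof.latticeConst (d + 1) (3 * δ / 160)) + CG * (((d : ℝ) + 1) * (Cl * r)) + CA * (Cρ * r) + CG * (((((d : ℝ) + 1) * Cρ * Real.exp ((3 * δ / 8) + (3 * δ / 160))) * (Cρ * Real.exp ((3 * δ / 8) + (3 * δ / 160))) * (B4Sect5Proof.latticeConst (d + 1) (3 * δ / 160))) * r) * (B4Sect5Proof.latticeConst (d + 1) (3 * δ / 160)) + α * (CG * (3 * (Cσ * r))) := by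
          linarith only [h1, h2, h3, h4, h5]
      _ = cXL ((d : ℝ) + 1) CG CA Cρ Cl Cσ α (B4Sect5Proof.latticeConst (d + 1) (3 * δ / 160)) (3 * δ / 8) (3 * δ / 160) * r := by unfold cXL; ring
  have eKX : cXL ((d : ℝ) + 1) CG CA Cρ Cl Cσ α (B4Sect5Proof.latticeConst (d + 1) (3 * δ / 160)) (3 * δ / 8) (3 * δ / 160) * r * (B4Sect5Proof.latticeConst (d + 1) (3 * δ / 160)) = cXL ((d : ℝ) + 1) CG CA Cρ Cl Cσ α (B4Sect5Proof.latticeConst (d + 1) (3 * δ / 160)) (3 * δ / 8) (3 * δ / 160) * (B4Sect5Proof.latticeConst (d + 1) (3 * δ / 160)) * r := mul_right_comm _ _ _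
  have hθKc : (CA * (((L ^ m * L ^ k : ℕ) : ℝ) * ρ₁ * Real.exp (3 * δ / 8)) * B4Sect5Proof.latticeConst (d + 1) (3 * δ / 160) + CG * (((d : ℝ) + 1) * ((L ^ m * L ^ k : ℕ) : ℝ) * (((L ^ m * L ^ k : ℕ) : ℝ) * lam₁)) + CA * (((L ^ m * L ^ k : ℕ) : ℝ) * ρ₁) + CG * (((L ^ m * L ^ k : ℕ) : ℝ) * ((d + 1 : ℕ) * ρ₁) * Real.exp (3 * δ / 8 + 3 * δ / 160) * (((L ^ m * L ^ k : ℕ) : ℝ) * ρ₁ * Real.exp (3 * δ / 8 + 3 * δ / 160)) * B4Sect5Proof.latticeConst (d + 1) (3 * δ / 160)) * B4Sect5Proof.latticeConst (d + 1) (3 * δ / 160) + |a'| * ((((L ^ m * L ^ k : ℕ) : ℝ) ^ (d + 1))⁻¹ * CG * (σ₁ * (1 + σ₁) + σ₁))) * (B4Sect5Proof.latticeConst (d + 1) (3 * δ / 160)) ≤ 1 / 2 := (mul_le_mul_of_nonneg_right hθK' hc2).trans ((le_of_eq eKX).trans hsmallK2)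
  have hqK : (CA * (((L ^ m * L ^ k : ℕ) : ℝ) * ρ₁ * Real.exp (3 * δ / 8)) * B4Sect5Proof.latticeConst (d + 1) (3 * δ / 160) + CG * (((d : ℝ) + 1) * ((L ^ m * L ^ k : ℕ) : ℝ) * (((L ^ m * L ^ k : ℕ) : ℝ) * lam₁)) + CA * (((L ^ m * L ^ k : ℕ) : ℝ) * ρ₁) + CG * (((L ^ m * L ^ k : ℕ) : ℝ) * ((d + 1 : ℕ) * ρ₁) * Real.exp (3 * δ / 8 + 3 * δ / 160) * (((L ^ m * L ^ k : ℕ) : ℝ) * ρ₁ * Real.exp (3 * δ / 8 + 3 * δ / 160)) * B4Sect5Proof.latticeConst (d + 1) (3 * δ / 160)) * B4Sect5Proof.latticeConst (d + 1) (3 * δ / 160) + |a'| * ((((L ^ m * L ^ k : ℕ) : ℝ) ^ (d + 1))⁻¹ * CG * (σ₁ * (1 + σ₁) + σ₁))) * (B4Sect5Proof.latticeConst (d + 1) (3 * δ / 160)) < 1 := lt_of_le_of_lt hθKc (by norm_num)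
  have hinvK : (1 - (CA * (((L ^ m * L ^ k : ℕ) : ℝ) * ρ₁ * Real.exp (3 * δ / 8)) * B4Sect5Proof.latticeConst (d + 1) (3 * δ / 160) + CG * (((d : ℝ) + 1) * ((L ^ m * L ^ k : ℕ) : ℝ) * (((L ^ m * L ^ k : ℕ) : ℝ) * lam₁)) + CA * (((L ^ m * L ^ k : ℕ) : ℝ) * ρ₁) + CG * (((L ^ m * L ^ k : ℕ) : ℝ) * ((d + 1 : ℕ) * ρ₁) * Real.exp (3 * δ / 8 + 3 * δ / 160) * (((L ^ m * L ^ k : ℕ) : ℝ) * ρ₁ * Real.exp (3 * δ / 8 + 3 * δ / 160)) * B4Sect5Proof.latticeConst (d + 1) (3 * δ / 160)) * B4Sect5Proof.latticeConst (d + 1) (3 * δ / 160) + |a'| * ((((L ^ m * L ^ k : ℕ) : ℝ) ^ (d + 1))⁻¹ * CG * (σ₁ * (1 + σ₁) + σ₁))) * (B4Sect5Proof.latticeConst (d + 1) (3 * δ / 160)))⁻¹ ≤ 2 := by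
    calc _ ≤ (1 / 2 : ℝ)⁻¹ := inv_anti₀ (by norm_num) (by rw [le_sub_comm]; exact hθKc.trans (by norm_num))
      _ = 2 := by norm_num
  have hinvK0 : 0 ≤ (1 - (CA * (((L ^ m * L ^ k : ℕ) : ℝ) * ρ₁ * Real.exp (3 * δ / 8)) * B4Sect5Proof.latticeConst (d + 1) (3 * δ / 160) + CG * (((d : ℝ) + 1) * ((L ^ m * L ^ k : ℕ) : ℝ) * (((L ^ m * L ^ k : ℕ) : ℝ) * lam₁)) + CA * (((L ^ m * L ^ k : ℕ) : ℝ) * ρ₁) + CG * (((L ^ m * L ^ k : ℕ) : ℝ) * ((d + 1 : ℕ) * ρ₁) * Real.exp (3 * δ / 8 + 3 * δ / 160) * (((L ^ m * L ^ k : ℕ) : ℝ) * ρ₁ * Real.exp (3 * δ / 8 + 3 * δ / 160)) * B4Sect5Proof.latticeConst (d + 1) (3 * δ / 160)) * B4Sect5Proof.latticeConst (d + 1) (3 * δ / 160) + |a'| * ((((L ^ m * L ^ k : ℕ) : ℝ) ^ (d + 1))⁻¹ * CG * (σ₁ * (1 + σ₁) + σ₁))) * (B4Sect5Proof.latticeConst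 (d + 1) (3 * δ / 160)))⁻¹ := inv_nonneg.mpr (sub_nonneg.mpr hqK.le)
  have hθZc : (((d : ℝ) + 1) * ((((L ^ m * L ^ k : ℕ) : ℝ)) * ρ₁) * (CDb + CD)) * (B4Sect5Proof.latticeConst (d + 1) (3 * δ / 160)) ≤ 1 / 2 := by
    have t : ((d : ℝ) + 1) * ((((L ^ m * L ^ k : ℕ) : ℝ)) * ρ₁) * (CDb + CD) * (B4Sect5Proof.latticeConst (d + 1) (3 * δ / 160)) ≤ ((d : ℝ) + 1) * (Cρ * r) * (CDb + CD) * (B4Sect5Proof.latticeConst (d + 1) (3 * δ / 160)) := by gcongr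
    have e : ((d : ℝ) + 1) * (Cρ * r) * (CDb + CD) * (B4Sect5Proof.latticeConst (d + 1) (3 * δ / 160)) = ((d : ℝ) + 1) * Cρ * (CDb + CD) * (B4Sect5Proof.latticeConst (d + 1) (3 * δ / 160)) * r := by ring
    exact t.trans ((le_of_eq e).trans hsmallZ)
  have hqZ : (((d : ℝ) + 1) * ((((L ^ m * L ^ k : ℕ) : ℝ)) * ρ₁) * (CDb + CD)) * (B4Sect5Proof.latticeConst (d + 1) (3 * δ / 160)) < 1 := lt_of_le_of_lt hθZc (by norm_num)
  have hinvZ : (1 - ((d : ℝ) + 1) * ((((L ^ m * L ^ k : ℕ) : ℝ)) * ρ₁) * (CDb + CD) * (B4Sect5Proof.latticeConst (d + 1) (3 * δ / 160)))⁻¹ ≤ 2 := by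
    calc _ ≤ (1 / 2 : ℝ)⁻¹ := inv_anti₀ (by norm_num) (by rw [le_sub_comm]; exact hθZc.trans (by norm_num))
      _ = 2 := by norm_num
  have hinvZ0 : 0 ≤ (1 - ((d : ℝ) + 1) * ((((L ^ m * L ^ k : ℕ) : ℝ)) * ρ₁) * (CDb + CD) * (B4Sect5Proof.latticeConst (d + 1) (3 * δ / 160)))⁻¹ := inv_nonneg.mpr (sub_nonneg.mpr hqZ.le)
  -- the flat one-grid rows and the two-grid kernel rows at the rate `3δ/8`
  have hS1i : HasMaj (BlockNorm.ofBlocks (unitTorusGeo L k M) (liftBlk (fun y : Tor M => y) ι)) (BlockNorm.ofBlocks (unitTorusGeo L k M) (liftBlk (fun y : Tor M => y) ι)) (Matrix.mulVecLin (cSop M (L ^ k) (fun (_ : Fin (d + 1)) (_ : Tor (fine (L ^ k) M)) => (1 : Matrix ι ι ℝ)) a)⁻¹) (fun y y' => (((((L ^ k : ℕ) : ℝ))) ^ (d + 1)) * CS * Real.exp (-((3 * δ / 8) * tdistT M y y'))) :=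
    (hS1.of_rate_le hd (by positivity) hr38).mono fun y y' => le_of_eq (by ring)
  have hS1i' : HasMaj (BlockNorm.ofBlocks (unitTorusGeo L k M) (liftBlk (fun y : Tor M => y) ι)) (BlockNorm.ofBlocks (unitTorusGeo L k M) (liftBlk (fun y : Tor M => y) ι)) (Matrix.mulVecLin (cSop M (L ^ m * L ^ k) (fun (_ : Fin (d + 1)) (_ : Tor (fine (L ^ m * L ^ k) M)) => (1 : Matrix ι ι ℝ)) a')⁻¹) (fun y y' => (((((L ^ m * L ^ k : ℕ) : ℝ))) ^ (d + 1)) * CS * Real.exp (-((3 * δ / 8) * tdistT M y y'))) :=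
    (hS1'.of_rate_le hd (by positivity) hr38).mono fun y y' => le_of_eq (by ring)
  -- n15-c∕242
  have h242 := hasMaj_idef_landauCov_sub_landauRe_of_rows M L k m hT ha hT' ha' hs2 hsδ2 hrow2 hc2
    h2CG hCY0 h2CG hCY0 (by positivity : (0 : ℝ) ≤ (CD + cPL ((d : ℝ) + 1) CG CD Cρ Cl Cσ α (B4Sect5Proof.latticeConst (d + 1) (δ / 8)) δ (δ / 8) * r)) (by positivity : (0 : ℝ) ≤ (CD + cPL ((d : ℝ) + 1) CG CD Cρ Cl Cσ α (B4Sect5Proof.latticeConst (d + 1) (δ / 8)) δ (δ / 8) * r)) (by positivity : (0 : ℝ) ≤ 2 * CS) (by positivity : (0 : ℝ) ≤ 2 * CS) hCG hCA hCD hCDb hCD hCDb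
    hρ0 hlam0 hlam0 hσ0 hτ0 hτ0 hρ₁0 hlam₁0 hlam₁0 hσ₁0 hτ0' hτ0' hεG hεA hεD hεDb hωN0 hωVt0 hωV0 hωm0 hφQ0 hφt0
    hρr hρc hlamc hlamr hσr hσc hτr hτc hρr' hρc' hlamc' hlamr' hσr' hσc' hτr' hτc'
    hX hY hX' hY' hDT hDT' hSi hSi'
    (hG1'.of_rate_le hd hCG hr38) (hA1'.of_rate_le hd hCA hr38) (hD1.of_rate_le hd hCD hr38) (hD1b.of_rate_le hd hCDb hr38) (hD1'.of_rate_le hd hCD hr38) (hD1b'.of_rate_le hd hCDb hr38)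
    (hDG.of_rate_le hd hεG hr38) (hDA.of_rate_le hd hεA hr38) (hDD.of_rate_le hd hεD hr38) (hDDb.of_rate_le hd hεDb hr38)
    hωNr hωNc hωNt hωVt hωV hωm hDQ hDQt hqK hqZ hCG hCS hCS (hG1.of_rate_le hd hCG hr38) hS1i hS1i'
  -- packaging (n15-c∕253): the 43 letter-free sub-words
  have hG1 : 0 ≤ (((CD + cPL ((d : ℝ) + 1) CG CD Cρ Cl Cσ α (B4Sect5Proof.latticeConst (d + 1) (δ / 8)) δ (δ / 8) * r) * (1 + σ₁) : ℝ)) ∧ 0 ≤ (((CD + cPL ((d : ℝ) + 1) CG CD Cρ Cl Cσ α (B4Sect5Proof.latticeConst (d + 1) (δ / 8)) δ (δ / 8)) * 2 : ℝ)) ∧ (((CD + cPL ((d : ℝ) + 1) CG CD Cρ Cl Cσ α (B4Sect5Proof.latticeConst (d + 1) (δ / 8)) δ (δ / 8) * r) * (1 + σ₁) : ℝ)) ≤ (CD + cPL ((d : ℝ) + 1) CG CD Cρ Cl Cσ α (B4Sect5Proof.latticeConst (d + 1) (δ / 8)) δ (δ / 8)) * 2 := ⟨by positivity, by positivity, mul_le_mul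 hCDTle hτ2' hτ0' (by positivity)⟩
  have hG2 : 0 ≤ ((2 * CS : ℝ)) ∧ 0 ≤ ((2 * CS : ℝ)) ∧ ((2 * CS : ℝ)) ≤ 2 * CS := pk_reflQ (by positivity)
  have hG3 : 0 ≤ ((((d : ℝ) + 1) * Fintype.card ι : ℝ)) ∧ 0 ≤ ((((d : ℝ) + 1) * Fintype.card ι : ℝ)) ∧ ((((d : ℝ) + 1) * Fintype.card ι : ℝ)) ≤ ((d : ℝ) + 1) * Fintype.card ι := pk_reflQ (by positivity)
  have hG4 : 0 ≤ ((2 * (CD + cAL ((d : ℝ) + 1) CD Cρ Cl Cσ α (B4Sect5Proof.latticeConst (d + 1) (δ / 8)) δ (δ / 8) * (2 * CG) * B4Sect5Proof.latticeConst (d + 1) (δ / 8)) : ℝ)) ∧ 0 ≤ ((2 * (CD + cAL ((d : ℝ) + 1) CD Cρ Cl Cσ α (B4Sect5Proof.latticeConst (d + 1) (δ / 8)) δ (δ / 8) * (2 * CG) * B4Sect5Proof.latticeConst (d + 1) (δ / 8)) : ℝ)) ∧ ((2 * (CD + cAL ((d : ℝ) + 1) CD Cρ Cl Cσ α (B4Sect5Proof.latticeConst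 (d + 1) (δ / 8)) δ (δ / 8) * (2 * CG) * B4Sect5Proof.latticeConst (d + 1) (δ / 8)) : ℝ)) ≤ 2 * (CD + cAL ((d : ℝ) + 1) CD Cρ Cl Cσ α (B4Sect5Proof.latticeConst (d + 1) (δ / 8)) δ (δ / 8) * (2 * CG) * B4Sect5Proof.latticeConst (d + 1) (δ / 8)) := pk_reflQ (by positivity)
  have hG5 : 0 ≤ ((CD : ℝ)) ∧ 0 ≤ ((CD : ℝ)) ∧ ((CD : ℝ)) ≤ CD := pk_reflQ (by positivity)
  have hG6 : 0 ≤ ((((d : ℝ) + 1) * ((L ^ m * L ^ k : ℕ) : ℝ) * (((L ^ m * L ^ k : ℕ) : ℝ) * lam₁) + ((d : ℝ) + 1) * (((L ^ m * L ^ k : ℕ) : ℝ) * ρ₁ * (((L ^ m * L ^ k : ℕ) : ℝ) * ρ₁)) + |a'| * ((((L ^ m * L ^ k : ℕ) : ℝ) ^ (d + 1))⁻¹ * (σ₁ * (1 + σ₁) + σ₁)) : ℝ)) ∧ 0 ≤ ((((d : ℝ) + 1) * Cl + ((d : ℝ) + 1) * (Cρ * Cρ) + α * (3 * Cσ) : ℝ))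 ∧ ((((d : ℝ) + 1) * ((L ^ m * L ^ k : ℕ) : ℝ) * (((L ^ m * L ^ k : ℕ) : ℝ) * lam₁) + ((d : ℝ) + 1) * (((L ^ m * L ^ k : ℕ) : ℝ) * ρ₁ * (((L ^ m * L ^ k : ℕ) : ℝ) * ρ₁)) + |a'| * ((((L ^ m * L ^ k : ℕ) : ℝ) ^ (d + 1))⁻¹ * (σ₁ * (1 + σ₁) + σ₁)) : ℝ)) ≤ ((d : ℝ) + 1) * Cl + ((d : ℝ) + 1) * (Cρ * Cρ) + α * (3 * Cσ) := ⟨by positivity, by positivity, hLET'⟩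
  have hG7 : 0 ≤ ((CA : ℝ)) ∧ 0 ≤ ((CA : ℝ)) ∧ ((CA : ℝ)) ≤ CA := pk_reflQ (by positivity)
  have hG8 : 0 ≤ ((Real.exp (3 * δ / 8 + 3 * δ / 160) * (2 * CG) * B4Sect5Proof.latticeConst (d + 1) (3 * δ / 160) : ℝ)) ∧ 0 ≤ ((Real.exp (3 * δ / 8 + 3 * δ / 160) * (2 * CG) * B4Sect5Proof.latticeConst (d + 1) (3 * δ / 160) : ℝ)) ∧ ((Real.exp (3 * δ / 8 + 3 * δ / 160) * (2 * CG) * B4Sect5Proof.latticeConst (d + 1) (3 * δ / 160) : ℝ)) ≤ Real.exp (3 * δ / 8 + 3 * δ / 160) * (2 * CG) * B4Sect5Proof.latticeConst (d + 1) (3 * δ / 160) := pk_reflQ (by positivity)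
  have hG9 : 0 ≤ ((((L ^ m * L ^ k : ℕ) : ℝ) * ρ₁ : ℝ)) ∧ 0 ≤ ((Cρ : ℝ)) ∧ ((((L ^ m * L ^ k : ℕ) : ℝ) * ρ₁ : ℝ)) ≤ Cρ := ⟨by positivity, by positivity, hn1'⟩
  have hG10 : 0 ≤ ((2 * (CD + cAL ((d : ℝ) + 1) CD Cρ Cl Cσ α (B4Sect5Proof.latticeConst (d + 1) (δ / 8)) δ (δ / 8) * (2 * CG) * B4Sect5Proof.latticeConst (d + 1) (δ / 8)) : ℝ)) ∧ 0 ≤ ((2 * (CD + cAL ((d : ℝ) + 1) CD Cρ Cl Cσ α (B4Sect5Proof.latticeConst (d + 1) (δ / 8)) δ (δ / 8) * (2 * CG) * B4Sect5Proof.latticeConst (d + 1) (δ / 8)) : ℝ)) ∧ ((2 * (CD + cAL ((d : ℝ) + 1) CD Cρ Cl Cσ α (B4Sect5Proof.latticeConst (d + 1) (δ / 8)) δ (δ / 8) * (2 * CG) * B4Sect5Proof.latticeConst (d + 1) (δ / 8)) : ℝ)) ≤ 2 * (CD + cAL ((d : ℝ) + 1) CD Cρ Cl Cσ α (B4Sect5Proof.latticeConst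 (d + 1) (δ / 8)) δ (δ / 8) * (2 * CG) * B4Sect5Proof.latticeConst (d + 1) (δ / 8)) := pk_reflQ (by positivity)
  have hG11 : 0 ≤ ((B4Sect5Proof.latticeConst (d + 1) (3 * δ / 160) : ℝ)) ∧ 0 ≤ ((B4Sect5Proof.latticeConst (d + 1) (3 * δ / 160) : ℝ)) ∧ ((B4Sect5Proof.latticeConst (d + 1) (3 * δ / 160) : ℝ)) ≤ B4Sect5Proof.latticeConst (d + 1) (3 * δ / 160) := pk_reflQ (by positivity)
  have hG12 : 0 ≤ ((((L ^ k : ℕ) : ℝ) * ρ * Real.exp (3 * δ / 8 + 3 * δ / 160) * (2 * CG) * B4Sect5Proof.latticeConst (d + 1) (3 * δ / 160) : ℝ)) ∧ 0 ≤ ((Cρ * Real.exp ((3 * δ / 8) + (3 * δ / 160)) * (2 * CG) * (B4Sect5Proof.latticeConst (d + 1) (3 * δ / 160)) : ℝ)) ∧ ((((L ^ k : ℕ) : ℝ) * ρ * Real.exp (3 * δ / 8 + 3 * δ / 160) * (2 * CG) * B4Sect5Proof.latticeConst (d + 1) (3 * δ / 160) : ℝ)) ≤ Cρ * Real.exp ((3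 * δ / 8) + (3 * δ / 160)) * (2 * CG) * (B4Sect5Proof.latticeConst (d + 1) (3 * δ / 160)) := ⟨by positivity, by positivity, mul_le_mul_of_nonneg_right (mul_le_mul_of_nonneg_right (mul_le_mul_of_nonneg_right hn1 (Real.exp_pos _).le) h2CG) hc2⟩
  have hG13 : 0 ≤ ((CG : ℝ)) ∧ 0 ≤ ((CG : ℝ)) ∧ ((CG : ℝ)) ≤ CG := pk_reflQ (by positivity)
  have hG14 : 0 ≤ ((2 * CG : ℝ)) ∧ 0 ≤ ((2 * CG : ℝ)) ∧ ((2 * CG : ℝ)) ≤ 2 * CG := pk_reflQ (by positivity)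
  have hG15 : 0 ≤ ((((d : ℝ) + 1) * ((L ^ k : ℕ) : ℝ) * (((L ^ k : ℕ) : ℝ) * lam) * (2 * CG) : ℝ)) ∧ 0 ≤ ((((d : ℝ) + 1) * Cl * (2 * CG) : ℝ)) ∧ ((((d : ℝ) + 1) * ((L ^ k : ℕ) : ℝ) * (((L ^ k : ℕ) : ℝ) * lam) * (2 * CG) : ℝ)) ≤ ((d : ℝ) + 1) * Cl * (2 * CG) := ⟨by positivity, by positivity, by rw [mul_assoc ((d : ℝ) + 1)]; exact mul_le_mul_of_nonneg_right (mul_le_mul_of_nonneg_left hl1 hD0) h2CG⟩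
  have hG16 : 0 ≤ ((((L ^ k : ℕ) : ℝ) * ρ * (2 * CG) : ℝ)) ∧ 0 ≤ ((Cρ * (2 * CG) : ℝ)) ∧ ((((L ^ k : ℕ) : ℝ) * ρ * (2 * CG) : ℝ)) ≤ Cρ * (2 * CG) := ⟨by positivity, by positivity, mul_le_mul_of_nonneg_right hn1 h2CG⟩
  have hG17 : 0 ≤ ((((d : ℝ) + 1) * (((L ^ k : ℕ) : ℝ) * ρ * (((L ^ k : ℕ) : ℝ) * ρ)) * (2 * CG) : ℝ)) ∧ 0 ≤ ((((d : ℝ) + 1) * (Cρ * Cρ) * (2 * CG) : ℝ)) ∧ ((((d : ℝ) + 1) * (((L ^ k : ℕ) : ℝ) * ρ * (((L ^ k : ℕ) : ℝ) * ρ)) * (2 * CG) : ℝ)) ≤ ((d : ℝ) + 1) * (Cρ * Cρ) * (2 * CG) := ⟨by positivity, by positivity, mul_le_mul_of_nonneg_right (mul_le_mul_of_nonneg_left (mul_le_mul hn1 hn1 (by positivity) hCρ) hD0) h2CG⟩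
  have hG18 : 0 ≤ ((|a| * ((((L ^ k : ℕ) : ℝ) ^ (d + 1))⁻¹ * (σ * (1 + σ) + σ)) * (2 * CG) : ℝ)) ∧ 0 ≤ ((α * (3 * Cσ) * (2 * CG) : ℝ)) ∧ ((|a| * ((((L ^ k : ℕ) : ℝ) ^ (d + 1))⁻¹ * (σ * (1 + σ) + σ)) * (2 * CG) : ℝ)) ≤ α * (3 * Cσ) * (2 * CG) := ⟨by positivity, by positivity, mul_le_mul_of_nonneg_right (by rw [← mul_assoc]; exact mul_le_mul haα hσ3 (by positivity) hα) h2CG⟩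
  have hG19 : 0 ≤ (((1 - (CA * (((L ^ m * L ^ k : ℕ) : ℝ) * ρ₁ * Real.exp (3 * δ / 8)) * B4Sect5Proof.latticeConst (d + 1) (3 * δ / 160) + CG * (((d : ℝ) + 1) * ((L ^ m * L ^ k : ℕ) : ℝ) * (((L ^ m * L ^ k : ℕ) : ℝ) * lam₁)) + CA * (((L ^ m * L ^ k : ℕ) : ℝ) * ρ₁) + CG * (((L ^ m * L ^ k : ℕ) : ℝ) * ((d + 1 : ℕ) * ρ₁) * Real.exp (3 * δ / 8 + 3 * δ / 160) * (((L ^ m * L ^ k : ℕ) : ℝ) * ρ₁ * Real.exp (3 * δ / 8 + 3 * δ / 160)) * B4Sect5Proof.latticeConst (d + 1) (3 * δ / 160)) * B4Sect5Proof.latticeConst (d + 1) (3 * δ / 160) + |a'| * ((((L ^ m * L ^ k : ℕ) : ℝ) ^ (d + 1))⁻¹ * CG * (σ₁ * (1 + σ₁) + σ₁))) * B4Sect5Proof.latticeConst (d + 1) (3 * δ / 160))⁻¹ : ℝ)) ∧ 0 ≤ ((2 : ℝ)) ∧ (((1 - (CA * (((L ^ m * L ^ k : ℕ) : ℝ) *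 ρ₁ * Real.exp (3 * δ / 8)) * B4Sect5Proof.latticeConst (d + 1) (3 * δ / 160) + CG * (((d : ℝ) + 1) * ((L ^ m * L ^ k : ℕ) : ℝ) * (((L ^ m * L ^ k : ℕ) : ℝ) * lam₁)) + CA * (((L ^ m * L ^ k : ℕ) : ℝ) * ρ₁) + CG * (((L ^ m * L ^ k : ℕ) : ℝ) * ((d + 1 : ℕ) * ρ₁) * Real.exp (3 * δ / 8 + 3 * δ / 160) * (((L ^ m * L ^ k : ℕ) : ℝ) * ρ₁ * Real.exp (3 * δ / 8 + 3 * δ / 160)) * B4Sect5Proof.latticeConst (d + 1) (3 * δ / 160)) * B4Sect5Proof.latticeConst (d + 1) (3 * δ / 160) + |a'| * ((((L ^ m * L ^ k : ℕ) : ℝ) ^ (d + 1))⁻¹ * CG * (σ₁ * (1 + σ₁) + σ₁))) * B4Sect5Proof.latticeConst (d + 1) (3 * δ / 160))⁻¹ : ℝ)) ≤ 2 := ⟨hinvK0, by norm_num, hinvK⟩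
  have hG20 : 0 ≤ (((((d : ℝ) + 1) * ((L ^ k : ℕ) : ℝ) * (((L ^ k : ℕ) : ℝ) * lam) + ((d : ℝ) + 1) * (((L ^ k : ℕ) : ℝ) * ρ * (((L ^ k : ℕ) : ℝ) * ρ)) + |a| * ((((L ^ k : ℕ) : ℝ) ^ (d + 1))⁻¹ * (σ * (1 + σ) + σ))) * (2 * CG) : ℝ)) ∧ 0 ≤ (((((d : ℝ) + 1) * Cl + ((d : ℝ) + 1) * (Cρ * Cρ) + α * (3 * Cσ)) * (2 * CG) : ℝ)) ∧ (((((d : ℝ) + 1) * ((L ^ k : ℕ) : ℝ) * (((L ^ k : ℕ) : ℝ) * lam) + ((d : ℝ) + 1) * (((L ^ k : ℕ) : ℝ) * ρ * (((L ^ k : ℕ) : ℝ) * ρ)) + |a| * ((((L ^ k : ℕ) : ℝ) ^ (d + 1))⁻¹ * (σ * (1 + σ) + σ))) * (2 * CG) : ℝ)) ≤ (((d : ℝ) + 1) * Cl + ((d : ℝ) + 1) * (Cρ * Cρ) + α * (3 * Cσ)) * (2 * CG) := ⟨by positivity, by positivity, mul_le_mul_of_nonneg_right hLET h2CG⟩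
  have hG21 : 0 ≤ ((((d : ℝ) + 1) * (((L ^ m * L ^ k : ℕ) : ℝ) * ρ₁) : ℝ)) ∧ 0 ≤ ((((d : ℝ) + 1) * Cρ : ℝ)) ∧ ((((d : ℝ) + 1) * (((L ^ m * L ^ k : ℕ) : ℝ) * ρ₁) : ℝ)) ≤ ((d : ℝ) + 1) * Cρ := ⟨by positivity, by positivity, mul_le_mul_of_nonneg_left hn1' hD0⟩
  have hG22 : 0 ≤ (((d : ℝ) + 1 : ℝ)) ∧ 0 ≤ (((d : ℝ) + 1 : ℝ)) ∧ (((d : ℝ) + 1 : ℝ)) ≤ (d : ℝ) + 1 := pk_reflQ (by positivity)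
  have hG23 : 0 ≤ ((CDb : ℝ)) ∧ 0 ≤ ((CDb : ℝ)) ∧ ((CDb : ℝ)) ≤ CDb := pk_reflQ (by positivity)
  have hG24 : 0 ≤ ((CD : ℝ)) ∧ 0 ≤ ((CD : ℝ)) ∧ ((CD : ℝ)) ≤ CD := pk_reflQ (by positivity)
  have hG25 : 0 ≤ ((((d : ℝ) + 1) * (((L ^ m * L ^ k : ℕ) : ℝ) * ρ₁) * (CDb + CD) : ℝ)) ∧ 0 ≤ ((((d : ℝ) + 1) * Cρ * (CDb + CD) : ℝ)) ∧ ((((d : ℝ) + 1) * (((L ^ m * L ^ k : ℕ) : ℝ) * ρ₁) * (CDb + CD) : ℝ)) ≤ ((d : ℝ) + 1) * Cρ * (CDb + CD) := ⟨by positivity, by positivity, mul_le_mul_of_nonneg_right (mul_le_mul_of_nonneg_left hn1' hD0) (by positivity)⟩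
  have hG26 : 0 ≤ ((((L ^ k : ℕ) : ℝ) * ((d + 1 : ℕ) * ρ) * Real.exp (3 * δ / 8 - 2 * (3 * δ / 160) + 3 * δ / 160) * (2 * (CD + cAL ((d : ℝ) + 1) CD Cρ Cl Cσ α (B4Sect5Proof.latticeConst (d + 1) (δ / 8)) δ (δ / 8) * (2 * CG) * B4Sect5Proof.latticeConst (d + 1) (δ / 8))) * B4Sect5Proof.latticeConst (d + 1) (3 * δ / 160) + ((d : ℝ) + 1) * (((L ^ k : ℕ) : ℝ) * ρ) * (2 * (CD + cAL ((d : ℝ) + 1) CD Cρ Cl Cσ α (B4Sect5Proof.latticeConst (d + 1) (δ / 8)) δ (δ / 8) * (2 * CG) * B4Sect5Proof.latticeConst (d + 1) (δ / 8))) : ℝ)) ∧ 0 ≤ ((((d : ℝ) + 1) * Cρ * Real.exp ((3 * δ / 8) - 2 * (3 * δ / 160) + (3 * δ / 160)) * (2 * (CD + cAL ((d : ℝ) + 1) CD Cρ Cl Cσ α (B4Sect5Proof.latticeConst (d + 1) (δ / 8)) δ (δ / 8) * (2 * CG) * (B4Sect5Proof.latticeConst (d + 1) (δ / 8)))) * (B4Sect5Proof.latticeConst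 (d + 1) (3 * δ / 160)) + ((d : ℝ) + 1) * Cρ * (2 * (CD + cAL ((d : ℝ) + 1) CD Cρ Cl Cσ α (B4Sect5Proof.latticeConst (d + 1) (δ / 8)) δ (δ / 8) * (2 * CG) * (B4Sect5Proof.latticeConst (d + 1) (δ / 8)))) : ℝ)) ∧ ((((L ^ k : ℕ) : ℝ) * ((d + 1 : ℕ) * ρ) * Real.exp (3 * δ / 8 - 2 * (3 * δ / 160) + 3 * δ / 160) * (2 * (CD + cAL ((d : ℝ) + 1) CD Cρ Cl Cσ α (B4Sect5Proof.latticeConst (d + 1) (δ / 8)) δ (δ / 8) * (2 * CG) * B4Sect5Proof.latticeConst (d + 1) (δ / 8))) * B4Sect5Proof.latticeConst (d + 1) (3 * δ / 160) + ((d : ℝ) + 1) * (((L ^ k : ℕ) : ℝ) * ρ) * (2 * (CD + cAL ((d : ℝ) + 1) CD Cρ Cl Cσ α (B4Sect5Proof.latticeConst (d + 1) (δ / 8)) δ (δ / 8) * (2 * CG) * B4Sect5Proof.latticeConst (d + 1) (δ / 8))) : ℝ)) ≤ ((d : ℝ) + 1) * Cρ * Real.exp ((3 * δ / 8) - 2 *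 (3 * δ / 160) + (3 * δ / 160)) * (2 * (CD + cAL ((d : ℝ) + 1) CD Cρ Cl Cσ α (B4Sect5Proof.latticeConst (d + 1) (δ / 8)) δ (δ / 8) * (2 * CG) * (B4Sect5Proof.latticeConst (d + 1) (δ / 8)))) * (B4Sect5Proof.latticeConst (d + 1) (3 * δ / 160)) + ((d : ℝ) + 1) * Cρ * (2 * (CD + cAL ((d : ℝ) + 1) CD Cρ Cl Cσ α (B4Sect5Proof.latticeConst (d + 1) (δ / 8)) δ (δ / 8) * (2 * CG) * (B4Sect5Proof.latticeConst (d + 1) (δ / 8)))) := ⟨by positivity, by positivity, add_le_add (mul_le_mul_of_nonneg_right (mul_le_mul_of_nonneg_right (mul_le_mul_of_nonneg_right hDρ (Real.exp_pos _).le) hCY0) hc2) (mul_le_mul_of_nonneg_right (mul_le_mul_of_nonneg_left hn1 hD0) hCY0)⟩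
  have hG27 : 0 ≤ (((1 - ((d : ℝ) + 1) * (((L ^ m * L ^ k : ℕ) : ℝ) * ρ₁) * (CDb + CD) * B4Sect5Proof.latticeConst (d + 1) (3 * δ / 160))⁻¹ : ℝ)) ∧ 0 ≤ ((2 : ℝ)) ∧ (((1 - ((d : ℝ) + 1) * (((L ^ m * L ^ k : ℕ) : ℝ) * ρ₁) * (CDb + CD) * B4Sect5Proof.latticeConst (d + 1) (3 * δ / 160))⁻¹ : ℝ)) ≤ 2 := ⟨hinvZ0, by norm_num, hinvZ⟩
  have hG28 : 0 ≤ ((1 + σ : ℝ)) ∧ 0 ≤ ((2 : ℝ)) ∧ ((1 + σ : ℝ)) ≤ 2 := ⟨by positivity, by positivity, hτ2⟩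
  have hG29 : 0 ≤ ((((L ^ m * L ^ k : ℕ) : ℝ) * ρ₁ * Real.exp (3 * δ / 8 - 5 * (3 * δ / 160) + 3 * δ / 160) : ℝ)) ∧ 0 ≤ ((Cρ * Real.exp ((3 * δ / 8) - 5 * (3 * δ / 160) + (3 * δ / 160)) : ℝ)) ∧ ((((L ^ m * L ^ k : ℕ) : ℝ) * ρ₁ * Real.exp (3 * δ / 8 - 5 * (3 * δ / 160) + 3 * δ / 160) : ℝ)) ≤ Cρ * Real.exp ((3 * δ / 8) - 5 * (3 * δ / 160) + (3 * δ / 160)) := ⟨by positivity, by positivity, mul_le_mul_of_nonneg_right hn1' (Real.exp_pos _).le⟩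
  have hG30 : 0 ≤ ((2 * CG : ℝ)) ∧ 0 ≤ ((2 * CG : ℝ)) ∧ ((2 * CG : ℝ)) ≤ 2 * CG := pk_reflQ (by positivity)
  have hG31 : 0 ≤ ((Real.exp (3 * δ / 8 - 5 * (3 * δ / 160) + 3 * δ / 160) * (2 * CG) * B4Sect5Proof.latticeConst (d + 1) (3 * δ / 160) : ℝ)) ∧ 0 ≤ ((Real.exp (3 * δ / 8 - 5 * (3 * δ / 160) + 3 * δ / 160) * (2 * CG) * B4Sect5Proof.latticeConst (d + 1) (3 * δ / 160) : ℝ)) ∧ ((Real.exp (3 * δ / 8 - 5 * (3 * δ / 160) + 3 * δ / 160) * (2 * CG) * B4Sect5Proof.latticeConst (d + 1) (3 * δ / 160) : ℝ)) ≤ Real.exp (3 * δ / 8 - 5 * (3 * δ / 160) + 3 * δ / 160) * (2 * CG) * B4Sect5Proof.latticeConst (d + 1) (3 * δ / 160) := pk_reflQ (by positivity)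
  have hG32 : 0 ≤ ((2 * CS * (2 * CS) : ℝ)) ∧ 0 ≤ ((2 * CS * (2 * CS) : ℝ)) ∧ ((2 * CS * (2 * CS) : ℝ)) ≤ 2 * CS * (2 * CS) := pk_reflQ (by positivity)
  have hG33 : 0 ≤ ((Fintype.card ι * (2 * CG * (1 + σ₁)) : ℝ)) ∧ 0 ≤ ((Fintype.card ι * ((2 * CG) * 2) : ℝ)) ∧ ((Fintype.card ι * (2 * CG * (1 + σ₁)) : ℝ)) ≤ Fintype.card ι * ((2 * CG) * 2) := ⟨by positivity, by positivity, mul_le_mul_of_nonneg_left (mul_le_mul_of_nonneg_left hτ2' h2CG) (Nat.cast_nonneg _)⟩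
  have hG34 : 0 ≤ ((Fintype.card ι : ℝ)) ∧ 0 ≤ ((Fintype.card ι : ℝ)) ∧ ((Fintype.card ι : ℝ)) ≤ Fintype.card ι := pk_reflQ (by positivity)
  have hG35 : 0 ≤ ((2 * CG * (1 + σ) : ℝ)) ∧ 0 ≤ (((2 * CG) * 2 : ℝ)) ∧ ((2 * CG * (1 + σ) : ℝ)) ≤ (2 * CG) * 2 := ⟨by positivity, by positivity, mul_le_mul_of_nonneg_left hτ2 h2CG⟩
  have hG36 : 0 ≤ ((((d : ℝ) + 1) * Fintype.card ι * ((CD + cPL ((d : ℝ) + 1) CG CD Cρ Cl Cσ α (B4Sect5Proof.latticeConst (d + 1) (δ / 8)) δ (δ / 8) * r) * (1 + σ)) : ℝ)) ∧ 0 ≤ ((((d : ℝ) + 1) * Fintype.card ι * ((CD + cPL ((d : ℝ) + 1) CG CD Cρ Cl Cσ α (B4Sect5Proof.latticeConst (d + 1) (δ / 8)) δ (δ / 8)) * 2) : ℝ)) ∧ ((((d : ℝ) + 1) * Fintype.card ι * ((CD + cPL ((d : ℝ) + 1) CG CD Cρ Cl Cσ α (B4Sect5Proof.latticeConst (d + 1)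 (δ / 8)) δ (δ / 8) * r) * (1 + σ)) : ℝ)) ≤ ((d : ℝ) + 1) * Fintype.card ι * ((CD + cPL ((d : ℝ) + 1) CG CD Cρ Cl Cσ α (B4Sect5Proof.latticeConst (d + 1) (δ / 8)) δ (δ / 8)) * 2) := ⟨by positivity, by positivity, mul_le_mul_of_nonneg_left (mul_le_mul hCDTle hτ2 hτ0 (by positivity)) (by positivity)⟩
  have hG37 : 0 ≤ ((2 * CS * (((d : ℝ) + 1) * Fintype.card ι * ((CD + cPL ((d : ℝ) + 1) CG CD Cρ Cl Cσ α (B4Sect5Proof.latticeConst (d + 1) (δ / 8)) δ (δ / 8) * r) * (1 + σ))) * B4Sect5Proof.latticeConst (d + 1) (3 * δ / 160) : ℝ)) ∧ 0 ≤ (((2 * CS) * (((d : ℝ) + 1) * Fintype.card ι * ((CD + cPL ((d : ℝ) + 1) CG CD Cρ Cl Cσ α (B4Sect5Proof.latticeConst (d + 1) (δ / 8)) δ (δ / 8)) * 2)) * (B4Sect5Proof.latticeConst (d + 1) (3 * δ / 160)) : ℝ)) ∧ ((2 * CS * (((d : ℝ) + 1) * Fintype.card ι * ((CD + cPL ((d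 : ℝ) + 1) CG CD Cρ Cl Cσ α (B4Sect5Proof.latticeConst (d + 1) (δ / 8)) δ (δ / 8) * r) * (1 + σ))) * B4Sect5Proof.latticeConst (d + 1) (3 * δ / 160) : ℝ)) ≤ (2 * CS) * (((d : ℝ) + 1) * Fintype.card ι * ((CD + cPL ((d : ℝ) + 1) CG CD Cρ Cl Cσ α (B4Sect5Proof.latticeConst (d + 1) (δ / 8)) δ (δ / 8)) * 2)) * (B4Sect5Proof.latticeConst (d + 1) (3 * δ / 160)) := ⟨by positivity, by positivity, mul_le_mul_of_nonneg_right (mul_le_mul_of_nonneg_left (mul_le_mul_of_nonneg_left (mul_le_mul hCDTle hτ2 hτ0 (by positivity)) (by positivity)) (by positivity)) hc2⟩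
  have hG38 : 0 ≤ ((CS : ℝ)) ∧ 0 ≤ ((CS : ℝ)) ∧ ((CS : ℝ)) ≤ CS := pk_reflQ (by positivity)
  have hG39 : 0 ≤ ((CS * CS : ℝ)) ∧ 0 ≤ ((CS * CS : ℝ)) ∧ ((CS * CS : ℝ)) ≤ CS * CS := pk_reflQ (by positivity)
  have hG40 : 0 ≤ ((Fintype.card ι * CG : ℝ)) ∧ 0 ≤ ((Fintype.card ι * CG : ℝ)) ∧ ((Fintype.card ι * CG : ℝ)) ≤ Fintype.card ι * CG := pk_reflQ (by positivity)
  have hG41 : 0 ≤ ((CG : ℝ)) ∧ 0 ≤ ((CG : ℝ)) ∧ ((CG : ℝ)) ≤ CG := pk_reflQ (by positivity)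
  have hG42 : 0 ≤ ((((d : ℝ) + 1) * Fintype.card ι * CD : ℝ)) ∧ 0 ≤ ((((d : ℝ) + 1) * Fintype.card ι * CD : ℝ)) ∧ ((((d : ℝ) + 1) * Fintype.card ι * CD : ℝ)) ≤ ((d : ℝ) + 1) * Fintype.card ι * CD := pk_reflQ (by positivity)
  have hG43 : 0 ≤ ((CS * (((d : ℝ) + 1) * Fintype.card ι * CD) * B4Sect5Proof.latticeConst (d + 1) (3 * δ / 160) : ℝ)) ∧ 0 ≤ ((CS * (((d : ℝ) + 1) * Fintype.card ι * CD) * B4Sect5Proof.latticeConst (d + 1) (3 * δ / 160) : ℝ)) ∧ ((CS * (((d : ℝ) + 1) * Fintype.card ι * CD) * B4Sect5Proof.latticeConst (d + 1) (3 * δ / 160) : ℝ)) ≤ CS * (((d : ℝ) + 1) * Fintype.card ι * CD) * B4Sect5Proof.latticeConst (d + 1) (3 * δ / 160) := pk_reflQ (by positivity)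
  have hE := defectRowConst_le hS0 hPεG hPεA hPεD hPεDb hPωN hPωVt hPωV hPωm hPφQ hPφt hPninv hG1 hG2 hG3 hG4 hG5 hG6 hG7 hG8 hG9 hG10 hG11 hG12 hG13 hG14 hG15 hG16 hG17 hG18 hG19 hG20 hG21 hG22 hG23 hG24 hG25 hG26 hG27 hG28 hG29 hG30 hG31 hG32 hG33 hG34 hG35 hG36 hG37 hG38 hG39 hG40 hG41 hG42 hG43
  have hK0 := defectRowConst_nonneg hS0 hPεG hPεA hPεD hPεDb hPωN hPωVt hPωV hPωm hPφQ hPφt hPninv hG1 hG2 hG3 hG4 hG5 hG6 hG7 hG8 hG9 hG10 hG11 hG12 hG13 hG14 hG15 hG16 hG17 hG18 hG19 hG20 hG21 hG22 hG23 hG24 hG25 hG26 hG27 hG28 hG29 hG30 hG31 hG32 hG33 hG34 hG35 hG36 hG37 hG38 hG39 hG40 hG41 hG42 hG43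
  refine ((h242.mono fun y y' => mul_le_mul_of_nonneg_right hE (Real.exp_nonneg _)).of_rate_le hd (mul_nonneg hS0 hK0) (by linarith : 3 * δ / 16 ≤ (3 * δ / 8) - 10 * (3 * δ / 160)))

end Main

end Summit.QuantumFields.YangMills.BalabanUVNodes.N15.CovLandau

end
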